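import Literature.NumberTheory.LFunctions.MauduitRivatTypeIIChain
import Literature.NumberTheory.LFunctions.MauduitRivatSmoothingCountSharp
import HarnessLib

/-!
# Mauduit–Rivat's type-II estimate for unitary matrices: choice of the parameters ((86)–(90); proved)

Everything in this file is PROVED. It completes the proof of the matrix-valued type-II estimate
(C. Mauduit, J. Rivat, *Prime numbers along Rudin–Shapiro sequences*, J. Eur. Math. Soc. 17
(2015), Prop. 2, §6.5; C. Müllner, Duke Math. J. 166 (2017), Prop. 5.5) from the chain
`MauduitRivatTypeIIChain` and the estimates of `S₄'` (`sum_sum_norm_corrS4rDiag_le`, with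
Lemma 10 `sum_sum_norm_sq_ghat_conj_mul_le`) and `S₄''` (`norm_corrS4rOff_le_n`), by inserting
the parameters (51), (57)–(60), (65), (67), (87) and checking the exponent inequalities
(86)–(90). Two deviations from the printed choice, both forced by the use made of the estimate
(blocks whose Cauchy–Schwarz variable `m` is the LONGER one, and an explicit power of `log`):
the smoothing error (64)–(70) is counted by exponential sums (`sum_box_min_le_sharp`) and
`S₄''` is summed over `n` first, so that no hypothesis `M ≤ N` is needed; and the saving
`ρ' ≤ γ(2ρ)/10` of (87) is taken with a free slack `g` (`10ρ' + g ≤ γ`), the margins `a`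
(in `ρ₃ = 4ρ' + a`) and `b` (in `λ' = ρ + 4ρ' + b`) being free as well, so that every
polynomial loss is multiplied by an explicit negative power of `k`:

* `norm_corrS3_sub_corrS4_le_sharp`, `sum_norm_corrS2_le_chain_sharp` — the chain of
  `MauduitRivatTypeIIChain` with the sharp smoothing count;
* `sum_Icc_S7_le` — `∑_{|a|≤k^{λ'}−1} S₇(a) ≤ 2 · (Lemma 10)`;
* **`typeIISq_le_params`** — for `k ≥ 2`, `‖B_n‖ ≤ 1`, `1 ≤ ρ`, `ρ' ≤ ρ`, `13ρ + 12ρ' ≤ μ`,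
  `11ρ + 6ρ' ≤ ν`, `a ≤ ρ`, `λ + 2ρ' + b = 3ρ`, `μ₀ = μ − 2ρ − 2ρ'`, `μ₀ ≤ c(λ + 4ρ' + a)`,
  `10ρ' + g ≤ γ(λ + 4ρ' + a)`:
  `T ≤ M N² ((2 + 24√d kC + 4√(2d))/k^ρ + 8 √(16dC + 20d + Ψ₁)/k^{ρ'})`
  with `Ψ₁ = P/k^ρ + 72 d² D Λ² k^{3a}/k^{2g} + 32 d² C D/k^a + 4 d² D Λ/k^b`, `D = τ(k^{μ+2ρ})`,
  `Λ = 1 + log k^{μ+2ρ}`, `P` an explicit polynomial in `d, C, D, Λ, k^{3a}` — i.e. MR's (90)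
  `|S_II|⁴ ≪ M⁴N⁴ k^{−2ρ'}` with every constant explicit.

## References
* C. Mauduit, J. Rivat, J. Eur. Math. Soc. 17 (2015), §6.5, (86)–(90); Prop. 2. [MauduitRivat2015]
* C. Müllner, Duke Math. J. 166 (2017) = arXiv:1602.03042, Prop. 5.5. [Mullner2017]
-/

noncomputable section

open Finset Complex Matrix

open scoped FourierTransform InnerProductSpace ComplexConjugate Matrix.Norms.Frobenius

namespace Literature.NumberTheory.LFunctions.MauduitRivat

variable {d : Type*} [Fintype d] [DecidableEq d] {G : Type*} [Group G]

/-! ## The chain with the sharp smoothing count -/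

/-- The double sum of `S₃ − S₄` over `(n, m)`, dominated by the sharp box bound
(drop the constraint on `m`, shift `n` by `r`, `sum_box_min_le_sharp`). [folklore] -/
theorem sum_sum_filter_min_le_sharp {k : ℕ} (hk : 0 < k) {μ₀ w : ℕ} (hw : w ≤ μ₀) {X : ℝ}
    (hX : 0 ≤ X) {M₀ M₁ N₀ N₁ : ℕ} (hM₀ : 1 ≤ M₀) (hN : N₀ ≤ N₁) (L r : ℕ) :
    ∑ n ∈ Ico N₀ N₁, ∑ m ∈ (Ico M₀ M₁).filter (fun m => m + L < M₁),
        min 1 (X / (gridDist (k ^ μ₀) (m * n + m * r) : ℝ)) ≤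
      (2 * (((k ^ w : ℕ) : ℝ) / (k ^ μ₀ : ℕ) * 2 * ((M₁ - M₀ : ℕ) : ℝ) * ((N₁ - N₀ : ℕ) : ℝ)) +
        4 * 2 * ((M₁ / k ^ μ₀ + 1 : ℕ) : ℝ) * (1 + Real.log ((k ^ μ₀ : ℕ) : ℝ)) *
          (2 * ((N₁ - N₀ : ℕ) : ℝ) * ((k ^ μ₀).divisors.card : ℝ) + 2 * (k ^ w : ℕ) +
            (k ^ μ₀ : ℕ) * (1 + Real.log ((k ^ μ₀ : ℕ) : ℝ))) +
        (2 * ((M₁ - M₀ : ℕ) : ℝ) * (((N₁ - N₀ : ℕ) : ℝ) / (k ^ w : ℕ) + 3) +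
          8 * ((k ^ w).divisors.card : ℝ) * M₁ * ((N₁ - N₀ : ℕ) : ℝ) / (k ^ w : ℕ))) +
      X / (k ^ w : ℕ) * (((M₁ - M₀ : ℕ) : ℝ) * ((N₁ - N₀ : ℕ) : ℝ)) := by
  have hnn : ∀ x : ℕ, 0 ≤ min 1 (X / (gridDist (k ^ μ₀) x : ℝ)) := fun x => by positivity
  calc ∑ n ∈ Ico N₀ N₁, ∑ m ∈ (Ico M₀ M₁).filter (fun m => m + L < M₁),
        min 1 (X / (gridDist (k ^ μ₀) (m * n + m * r) : ℝ))
      ≤ ∑ n ∈ Ico N₀ N₁, ∑ m ∈ Ico M₀ M₁, min 1 (X / (gridDist (k ^ μ₀) (m * n + m * r) : ℝ)) :=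
        sum_le_sum fun n _ => sum_le_sum_of_subset_of_nonneg (filter_subset _ _) fun m _ _ => hnn _
    _ = ∑ p ∈ (Ico M₀ M₁) ×ˢ (Ico (N₀ + r) (N₀ + r + (N₁ - N₀))),
          min 1 (X / (gridDist (k ^ μ₀) (p.1 * p.2 + 0) : ℝ)) := by
        rw [sum_product, sum_comm]
        have e : Ico (N₀ + r) (N₀ + r + (N₁ - N₀)) = (Ico N₀ N₁).map (addRightEmbedding r) := by
          rw [Finset.map_add_right_Ico]; congr 1; omega
        rw [e]
        refine sum_congr rfl fun m _ => ?_
        rw [sum_map]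
        refine sum_congr rfl fun n _ => ?_
        simp only [addRightEmbedding_apply, add_zero, mul_add]
    _ ≤ _ := sum_box_min_le_sharp hk hw hX 0 hM₀ (N₀ + r) (N₁ - N₀)

/-- **(64)–(70), sharp smoothing count**: for `k ≥ 1`, `w ≤ μ₀ ≤ μ₂`, `0 < H ≤ k^{μ₂}`,
`1 ≤ M₀`, `N₀ ≤ N₁`, `|S₃(s) − S₄(s)| ≤ 4 d R · (sharp box bound with X = k^{μ₂}/H)`.
[cite: MauduitRivat2015, (64)–(70)] [cite: Mullner2017, §5.4.2] -/
theorem norm_corrS3_sub_corrS4_le_sharp (U : G →* unitaryGroup d ℂ) (f : ℕ → G) {k : ℕ} (hk : 0 < k)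
    {μ₀ μ₁ μ₂ Hs w : ℕ} (hμ : μ₀ ≤ μ₂) (hw : w ≤ μ₀) (hH : 0 < Hs) (hHK : Hs ≤ k ^ μ₂) (ϑ : ℝ)
    {M₀ M₁ N₀ N₁ : ℕ} (hM₀ : 1 ≤ M₀) (hN : N₀ ≤ N₁) (R s : ℕ) :
    ‖corrS3 U f k μ₀ μ₁ μ₂ ϑ M₀ M₁ N₀ N₁ R s - corrS4 U f k μ₀ μ₁ μ₂ Hs ϑ M₀ M₁ N₀ N₁ R s‖ ≤
      4 * Fintype.card d * R *
        ((2 * (((k ^ w : ℕ) : ℝ) / (k ^ μ₀ : ℕ) * 2 * ((M₁ - M₀ : ℕ) : ℝ) * ((N₁ - N₀ : ℕ) : ℝ)) +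
          4 * 2 * ((M₁ / k ^ μ₀ + 1 : ℕ) : ℝ) * (1 + Real.log ((k ^ μ₀ : ℕ) : ℝ)) *
            (2 * ((N₁ - N₀ : ℕ) : ℝ) * ((k ^ μ₀).divisors.card : ℝ) + 2 * (k ^ w : ℕ) +
              (k ^ μ₀ : ℕ) * (1 + Real.log ((k ^ μ₀ : ℕ) : ℝ))) +
          (2 * ((M₁ - M₀ : ℕ) : ℝ) * (((N₁ - N₀ : ℕ) : ℝ) / (k ^ w : ℕ) + 3) +
            8 * ((k ^ w).divisors.card : ℝ) * M₁ * ((N₁ - N₀ : ℕ) : ℝ) / (k ^ w : ℕ))) +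
        (k ^ μ₂ : ℝ) / Hs / (k ^ w : ℕ) * (((M₁ - M₀ : ℕ) : ℝ) * ((N₁ - N₀ : ℕ) : ℝ))) := by
  have hX : (0 : ℝ) ≤ (k ^ μ₂ : ℝ) / Hs := by positivity
  set SM := (2 * (((k ^ w : ℕ) : ℝ) / (k ^ μ₀ : ℕ) * 2 * ((M₁ - M₀ : ℕ) : ℝ) * ((N₁ - N₀ : ℕ) : ℝ)) +
          4 * 2 * ((M₁ / k ^ μ₀ + 1 : ℕ) : ℝ) * (1 + Real.log ((k ^ μ₀ : ℕ) : ℝ)) *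
            (2 * ((N₁ - N₀ : ℕ) : ℝ) * ((k ^ μ₀).divisors.card : ℝ) + 2 * (k ^ w : ℕ) +
              (k ^ μ₀ : ℕ) * (1 + Real.log ((k ^ μ₀ : ℕ) : ℝ))) +
          (2 * ((M₁ - M₀ : ℕ) : ℝ) * (((N₁ - N₀ : ℕ) : ℝ) / (k ^ w : ℕ) + 3) +
            8 * ((k ^ w).divisors.card : ℝ) * M₁ * ((N₁ - N₀ : ℕ) : ℝ) / (k ^ w : ℕ))) +
        (k ^ μ₂ : ℝ) / Hs / (k ^ w : ℕ) * (((M₁ - M₀ : ℕ) : ℝ) * ((N₁ - N₀ : ℕ) : ℝ)) with hSM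
  have hSM0 : 0 ≤ SM := by
    have : (0 : ℝ) ≤ Real.log ((k ^ μ₀ : ℕ) : ℝ) := Real.log_natCast_nonneg _
    positivity
  refine (norm_corrS3_sub_corrS4_le U f hk hμ hH hHK ϑ M₀ M₁ N₀ N₁ R s).trans ?_
  have hdiv : ∀ x : ℕ, (k ^ μ₂ : ℝ) / (Hs * gridDist (k ^ μ₀) x) =
      (k ^ μ₂ : ℝ) / Hs / (gridDist (k ^ μ₀) x : ℝ) := fun x => by rw [div_div]
  have hr : ∀ r ∈ Ico 1 R, ∑ n ∈ Ico N₀ N₁, ∑ m ∈ (Ico M₀ M₁).filter (fun m => m + s * k ^ μ₁ < M₁),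
      (min 1 ((k ^ μ₂ : ℝ) / (Hs * gridDist (k ^ μ₀) (m * n))) +
        min 1 ((k ^ μ₂ : ℝ) / (Hs * gridDist (k ^ μ₀) (m * n + m * r)))) ≤ SM + SM := by
    intro r _
    simp only [hdiv, sum_add_distrib]
    refine add_le_add ?_ ?_
    · have h := sum_sum_filter_min_le_sharp hk hw hX hM₀ hN (s * k ^ μ₁) 0 (M₁ := M₁) (N₁ := N₁)
      simp only [mul_zero, add_zero] at h
      exact h
    · exact sum_sum_filter_min_le_sharp hk hw hX hM₀ hN (s * k ^ μ₁) r
  calc 2 * (Fintype.card d : ℝ) * ∑ r ∈ Ico 1 R, ∑ n ∈ Ico N₀ N₁,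
        ∑ m ∈ (Ico M₀ M₁).filter (fun m => m + s * k ^ μ₁ < M₁),
          (min 1 ((k ^ μ₂ : ℝ) / (Hs * gridDist (k ^ μ₀) (m * n))) +
            min 1 ((k ^ μ₂ : ℝ) / (Hs * gridDist (k ^ μ₀) (m * n + m * r))))
      ≤ 2 * (Fintype.card d : ℝ) * ∑ _r ∈ Ico 1 R, (SM + SM) :=
        mul_le_mul_of_nonneg_left (sum_le_sum hr) (by positivity)
    _ = 2 * (Fintype.card d : ℝ) * (((R - 1 : ℕ) : ℝ) * (SM + SM)) := by
        rw [sum_const, Nat.card_Ico, nsmul_eq_mul]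
    _ ≤ 2 * (Fintype.card d : ℝ) * ((R : ℝ) * (SM + SM)) := by
        have : ((R - 1 : ℕ) : ℝ) ≤ R := by exact_mod_cast Nat.sub_le R 1
        gcongr
    _ = _ := by rw [hSM]; ring

/-- **(62)–(72) chained, sharp smoothing count, summed over `s`**: for `k ≥ 1`,
`μ₀ ≤ μ₁ ≤ μ₂`, `w ≤ μ₀`, `0 < H ≤ k^{μ₂}`, `1 ≤ M₀`, `N₀ ≤ N₁`, `#(midViolations) ≤ nB`,
`∑_{1≤s<S} |S₂'(s)| ≤ S · (8dR·scBound + 4dR·(sharp smoothing bound)) + ∑_s∑_r |S₄'(r,s)| + ∑_s∑_r |S₄''(r,s)|`.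
[cite: MauduitRivat2015, (55)–(72)] [cite: Mullner2017, §5.4.2] -/
theorem sum_norm_corrS2_le_chain_sharp (U : G →* unitaryGroup d ℂ) (f : ℕ → G) {k : ℕ} (hk : 0 < k)
    {μ₀ μ₁ μ₂ Hs w : ℕ} (h01 : μ₀ ≤ μ₁) (h12 : μ₁ ≤ μ₂) (hw : w ≤ μ₀) (hH : 0 < Hs)
    (hHK : Hs ≤ k ^ μ₂) (ϑ : ℝ) {M₀ M₁ N₀ N₁ : ℕ} (hM₀ : 1 ≤ M₀) (hN : N₀ ≤ N₁) (R S : ℕ)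
    {nB : ℝ} (hnB : ((midViolations k μ₀ μ₁ μ₂ f).card : ℝ) ≤ nB) :
    ∑ s ∈ Ico 1 S, ‖corrS2 ϑ (umat U (trunc k μ₂ f)) M₀ M₁ N₀ N₁ R (k ^ μ₁) s‖ ≤
      (S : ℝ) * (8 * Fintype.card d * R * scBound k μ₀ μ₂ nB (M₁ - M₀) M₁ (N₁ - N₀) +
          4 * Fintype.card d * R *
            ((2 * (((k ^ w : ℕ) : ℝ) / (k ^ μ₀ : ℕ) * 2 * ((M₁ - M₀ : ℕ) : ℝ) * ((N₁ - N₀ : ℕ) : ℝ)) +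
              4 * 2 * ((M₁ / k ^ μ₀ + 1 : ℕ) : ℝ) * (1 + Real.log ((k ^ μ₀ : ℕ) : ℝ)) *
                (2 * ((N₁ - N₀ : ℕ) : ℝ) * ((k ^ μ₀).divisors.card : ℝ) + 2 * (k ^ w : ℕ) +
                  (k ^ μ₀ : ℕ) * (1 + Real.log ((k ^ μ₀ : ℕ) : ℝ))) +
              (2 * ((M₁ - M₀ : ℕ) : ℝ) * (((N₁ - N₀ : ℕ) : ℝ) / (k ^ w : ℕ) + 3) +
                8 * ((k ^ w).divisors.card : ℝ) * M₁ * ((N₁ - N₀ : ℕ) : ℝ) / (k ^ w : ℕ))) +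
            (k ^ μ₂ : ℝ) / Hs / (k ^ w : ℕ) * (((M₁ - M₀ : ℕ) : ℝ) * ((N₁ - N₀ : ℕ) : ℝ)))) +
        ∑ s ∈ Ico 1 S, ∑ r ∈ Ico 1 R, ‖corrS4rDiag U f k μ₀ μ₁ μ₂ Hs M₀ M₁ N₀ N₁ r s‖ +
        ∑ s ∈ Ico 1 S, ∑ r ∈ Ico 1 R, ‖corrS4rOff U f k μ₀ μ₁ μ₂ Hs M₀ M₁ N₀ N₁ r s‖ := by
  have h02 : μ₀ ≤ μ₂ := h01.trans h12
  have hnB0 : 0 ≤ nB := le_trans (Nat.cast_nonneg _) hnB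
  set SC := scBound k μ₀ μ₂ nB (M₁ - M₀) M₁ (N₁ - N₀) with hSC
  set SM := (2 * (((k ^ w : ℕ) : ℝ) / (k ^ μ₀ : ℕ) * 2 * ((M₁ - M₀ : ℕ) : ℝ) * ((N₁ - N₀ : ℕ) : ℝ)) +
          4 * 2 * ((M₁ / k ^ μ₀ + 1 : ℕ) : ℝ) * (1 + Real.log ((k ^ μ₀ : ℕ) : ℝ)) *
            (2 * ((N₁ - N₀ : ℕ) : ℝ) * ((k ^ μ₀).divisors.card : ℝ) + 2 * (k ^ w : ℕ) +
              (k ^ μ₀ : ℕ) * (1 + Real.log ((k ^ μ₀ : ℕ) : ℝ))) +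
          (2 * ((M₁ - M₀ : ℕ) : ℝ) * (((N₁ - N₀ : ℕ) : ℝ) / (k ^ w : ℕ) + 3) +
            8 * ((k ^ w).divisors.card : ℝ) * M₁ * ((N₁ - N₀ : ℕ) : ℝ) / (k ^ w : ℕ))) +
        (k ^ μ₂ : ℝ) / Hs / (k ^ w : ℕ) * (((M₁ - M₀ : ℕ) : ℝ) * ((N₁ - N₀ : ℕ) : ℝ)) with hSM
  have hSC0 : 0 ≤ SC := scBound_nonneg k μ₀ μ₂ hnB0 _ _ _
  have hSM0 : 0 ≤ SM := by
    have : (0 : ℝ) ≤ Real.log ((k ^ μ₀ : ℕ) : ℝ) := Real.log_natCast_nonneg _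
    positivity
  have hs : ∀ s ∈ Ico 1 S, ‖corrS2 ϑ (umat U (trunc k μ₂ f)) M₀ M₁ N₀ N₁ R (k ^ μ₁) s‖ ≤
      (8 * Fintype.card d * R * SC + 4 * Fintype.card d * R * SM) +
        (∑ r ∈ Ico 1 R, ‖corrS4rDiag U f k μ₀ μ₁ μ₂ Hs M₀ M₁ N₀ N₁ r s‖ +
          ∑ r ∈ Ico 1 R, ‖corrS4rOff U f k μ₀ μ₁ μ₂ Hs M₀ M₁ N₀ N₁ r s‖) := by
    intro s _
    have a := norm_corrS2_sub_corrS3_le_sc U f hk h01 h12 ϑ hM₀ hN R s hnB (M₁ := M₁) (N₁ := N₁)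
    have b := norm_corrS3_sub_corrS4_le_sharp U f hk h02 hw hH hHK ϑ hM₀ hN R s
      (μ₁ := μ₁) (M₁ := M₁) (N₁ := N₁)
    have c := norm_corrS4_le_sum U f hk h01 h12 Hs ϑ M₀ M₁ N₀ N₁ R s
    rw [sum_add_distrib] at c
    have tri : ‖corrS2 ϑ (umat U (trunc k μ₂ f)) M₀ M₁ N₀ N₁ R (k ^ μ₁) s‖ ≤
        ‖corrS2 ϑ (umat U (trunc k μ₂ f)) M₀ M₁ N₀ N₁ R (k ^ μ₁) s -
            corrS3 U f k μ₀ μ₁ μ₂ ϑ M₀ M₁ N₀ N₁ R s‖ +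
          ‖corrS3 U f k μ₀ μ₁ μ₂ ϑ M₀ M₁ N₀ N₁ R s - corrS4 U f k μ₀ μ₁ μ₂ Hs ϑ M₀ M₁ N₀ N₁ R s‖ +
          ‖corrS4 U f k μ₀ μ₁ μ₂ Hs ϑ M₀ M₁ N₀ N₁ R s‖ := by
      have := norm_add₃_le (a := corrS2 ϑ (umat U (trunc k μ₂ f)) M₀ M₁ N₀ N₁ R (k ^ μ₁) s -
            corrS3 U f k μ₀ μ₁ μ₂ ϑ M₀ M₁ N₀ N₁ R s)
          (b := corrS3 U f k μ₀ μ₁ μ₂ ϑ M₀ M₁ N₀ N₁ R s - corrS4 U f k μ₀ μ₁ μ₂ Hs ϑ M₀ M₁ N₀ N₁ R s)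
          (c := corrS4 U f k μ₀ μ₁ μ₂ Hs ϑ M₀ M₁ N₀ N₁ R s)
      simpa only [sub_add_sub_cancel, sub_add_cancel] using this
    rw [hSM]
    linarith
  refine (sum_le_sum hs).trans ?_
  simp only [sum_add_distrib, sum_const, Nat.card_Ico, nsmul_eq_mul]
  have hS1 : ((S - 1 : ℕ) : ℝ) ≤ S := by exact_mod_cast Nat.sub_le S 1
  have hA : 0 ≤ 8 * (Fintype.card d : ℝ) * R * SC := by positivity
  have hB' : 0 ≤ 4 * (Fintype.card d : ℝ) * R * SM := by positivity
  have hA' : 0 ≤ 8 * (Fintype.card d : ℝ) * R * SC + 4 * (Fintype.card d : ℝ) * R * SM := by positivity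
  nlinarith [mul_le_mul_of_nonneg_right hS1 hA, mul_le_mul_of_nonneg_right hS1 hB',
    mul_le_mul_of_nonneg_right hS1 hA']

/-! ## The final combination (55)–(56), (86)–(90) in abstract form -/

/-- `√(x + y) ≤ √x + √y` for `x, y ≥ 0`. [folklore] -/
private theorem sqrt_add_le_sqrt_add_sqrt {x y : ℝ} (hx : 0 ≤ x) (hy : 0 ≤ y) :
    Real.sqrt (x + y) ≤ Real.sqrt x + Real.sqrt y := by
  have h1 := Real.sq_sqrt hx
  have h2 := Real.sq_sqrt hy
  have h3 := Real.sqrt_nonneg x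
  have h4 := Real.sqrt_nonneg y
  calc Real.sqrt (x + y) ≤ Real.sqrt ((Real.sqrt x + Real.sqrt y) ^ 2) :=
        Real.sqrt_le_sqrt (by nlinarith)
    _ = Real.sqrt x + Real.sqrt y := Real.sqrt_sq (by positivity)

/-- **The skeleton of (55)–(56) and (90)**: from the opened bound for `T` (`typeIISq_le_open`), the
second van der Corput bound for `Y` (`sum_innerY_le_vdC` with `k^{μ₁}S = M`), a bound
`XS · P² ≤ RSMN · Ψ` for `∑_s |S₂'(s)|`, the carry count `EB · R ≤ 3kC·MN`, `S = R²`, `R ≤ N`: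
`T ≤ M N² ((2 + 24√d kC + 4√(2d))/R + 8√Ψ/P)`. [cite: MauduitRivat2015, (55)–(56), (90)] -/
theorem typeII_final_abstract {T M N M' N' R S EB YS XS Ψ d₀ kC P : ℝ}
    (hM : 0 < M) (hN : 0 < N) (hR : 0 < R) (hP : 0 < P) (hd : 0 ≤ d₀) (hΨ : 0 ≤ Ψ)
    (hM'0 : 0 ≤ M') (hM'M : M' ≤ M) (hN'0 : 0 ≤ N') (hN'N : N' ≤ N) (hRN : R ≤ N) (hS : S = R ^ 2)
    (hEB0 : 0 ≤ EB) (hYS0 : 0 ≤ YS) (hXS0 : 0 ≤ XS)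
    (hT : T ≤ ((N' + R) / R) * (M' * N' + 4 * Real.sqrt d₀ * R * EB + 2 * Real.sqrt (N' * (R * YS))))
    (hYS : YS ≤ ((M' + M) / S) * (d₀ * R * N' * M' + 2 * XS))
    (hXS : XS * P ^ 2 ≤ R * S * M * N * Ψ)
    (hEB : EB * R ≤ 3 * kC * M * N) :
    T ≤ M * N ^ 2 * ((2 + 24 * Real.sqrt d₀ * kC + 4 * Real.sqrt (2 * d₀)) / R + 8 * Real.sqrt Ψ / P) := by
  have hSpos : 0 < S := by rw [hS]; positivity
  -- the `Y`-bound with `M`, `N`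
  have hYS' : YS ≤ (2 * M / S) * (d₀ * R * N * M + 2 * XS) := by
    refine hYS.trans (mul_le_mul ?_ ?_ (by positivity) (by positivity))
    · exact div_le_div_of_nonneg_right (by linarith) hSpos.le
    · have : d₀ * R * N' * M' ≤ d₀ * R * N * M := by
        have h1 : d₀ * R * N' ≤ d₀ * R * N := mul_le_mul_of_nonneg_left hN'N (by positivity)
        exact mul_le_mul h1 hM'M hM'0 (by positivity)
      linarith
  -- the quantity under the square root
  have hXS' : XS ≤ R * S * M * N * Ψ / P ^ 2 := by
    rw [le_div_iff₀ (by positivity)]; exact hXS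
  have key : N' * (R * YS) ≤ (M * N * R) ^ 2 * (2 * d₀ / S + 4 * Ψ / P ^ 2) := by
    have h1 : N' * (R * YS) ≤ N * (R * ((2 * M / S) * (d₀ * R * N * M + 2 * XS))) :=
      mul_le_mul hN'N (mul_le_mul_of_nonneg_left hYS' hR.le) (by positivity) hN.le
    have h2 : N * (R * ((2 * M / S) * (d₀ * R * N * M + 2 * XS))) ≤
        N * (R * ((2 * M / S) * (d₀ * R * N * M + 2 * (R * S * M * N * Ψ / P ^ 2)))) := by
      gcongr
    refine h1.trans (h2.trans (le_of_eq ?_))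
    field_simp
    ring
  have hsq : Real.sqrt (N' * (R * YS)) ≤ M * N * R * (Real.sqrt (2 * d₀) / R + 2 * Real.sqrt Ψ / P) := by
    calc Real.sqrt (N' * (R * YS)) ≤ Real.sqrt ((M * N * R) ^ 2 * (2 * d₀ / S + 4 * Ψ / P ^ 2)) :=
          Real.sqrt_le_sqrt key
      _ = M * N * R * Real.sqrt (2 * d₀ / S + 4 * Ψ / P ^ 2) := by
          rw [Real.sqrt_mul (by positivity), Real.sqrt_sq (by positivity)]
      _ ≤ M * N * R * (Real.sqrt (2 * d₀ / S) + Real.sqrt (4 * Ψ / P ^ 2)) :=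
          mul_le_mul_of_nonneg_left (sqrt_add_le_sqrt_add_sqrt (by positivity) (by positivity))
            (by positivity)
      _ = M * N * R * (Real.sqrt (2 * d₀) / R + 2 * Real.sqrt Ψ / P) := by
          congr 1
          rw [Real.sqrt_div (by positivity), hS, Real.sqrt_sq hR.le, Real.sqrt_div (by positivity),
            Real.sqrt_sq hP.le, Real.sqrt_mul (by norm_num : (0:ℝ) ≤ 4),
            show Real.sqrt 4 = 2 by rw [show (4:ℝ) = 2 ^ 2 by norm_num, Real.sqrt_sq (by norm_num)]]
  -- assemble
  have hNR : (N' + R) / R ≤ 2 * N / R := div_le_div_of_nonneg_right (by linarith) hR.le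
  have hEB' : 4 * Real.sqrt d₀ * R * EB ≤ 4 * Real.sqrt d₀ * (3 * kC * M * N) := by
    have : 4 * Real.sqrt d₀ * R * EB = 4 * Real.sqrt d₀ * (EB * R) := by ring
    rw [this]
    exact mul_le_mul_of_nonneg_left hEB (by positivity)
  have hMN' : M' * N' ≤ M * N := mul_le_mul hM'M hN'N hN'0 hM.le
  have hin : M' * N' + 4 * Real.sqrt d₀ * R * EB + 2 * Real.sqrt (N' * (R * YS)) ≤
      M * N + 4 * Real.sqrt d₀ * (3 * kC * M * N) +
        2 * (M * N * R * (Real.sqrt (2 * d₀) / R + 2 * Real.sqrt Ψ / P)) := by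
    linarith [mul_le_mul_of_nonneg_left hsq (by norm_num : (0:ℝ) ≤ 2)]
  have hin0 : 0 ≤ M' * N' + 4 * Real.sqrt d₀ * R * EB + 2 * Real.sqrt (N' * (R * YS)) := by positivity
  calc T ≤ ((N' + R) / R) * (M' * N' + 4 * Real.sqrt d₀ * R * EB + 2 * Real.sqrt (N' * (R * YS))) := hT
    _ ≤ (2 * N / R) * (M * N + 4 * Real.sqrt d₀ * (3 * kC * M * N) +
        2 * (M * N * R * (Real.sqrt (2 * d₀) / R + 2 * Real.sqrt Ψ / P))) :=
        mul_le_mul hNR hin hin0 (by positivity)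
    _ = M * N ^ 2 * ((2 + 24 * Real.sqrt d₀ * kC + 4 * Real.sqrt (2 * d₀)) / R + 8 * Real.sqrt Ψ / P) := by
        field_simp
        ring

/-! ## Small arithmetic helpers -/

/-- `k^a ≤ k^b` for `a ≤ b`, `k ≥ 1` (real form). [folklore] -/
theorem kpow_le {k : ℕ} (hk : 1 ≤ k) {a b : ℕ} (h : a ≤ b) : (k : ℝ) ^ a ≤ (k : ℝ) ^ b :=
  pow_le_pow_right₀ (by exact_mod_cast hk) h

/-- `τ(m) ≤ τ(n)` for `m ∣ n ≠ 0` (real form). [folklore] -/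
theorem card_divisors_le_of_dvd_real {m n : ℕ} (h : m ∣ n) (hn : n ≠ 0) :
    (m.divisors.card : ℝ) ≤ n.divisors.card := by
  exact_mod_cast card_le_card (Nat.divisors_subset_of_dvd hn h)

/-- `τ(k^a) ≤ τ(k^b)` for `a ≤ b`, `k ≥ 1`. [folklore] -/
theorem card_divisors_pow_le {k : ℕ} (hk : 0 < k) {a b : ℕ} (h : a ≤ b) :
    ((k ^ a).divisors.card : ℝ) ≤ (k ^ b).divisors.card :=
  card_divisors_le_of_dvd_real (pow_dvd_pow k h) (pow_pos hk b).ne'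

/-- `1 + log k^a ≤ 1 + log k^b` for `a ≤ b`, `k ≥ 1`. [folklore] -/
theorem one_add_log_pow_le {k : ℕ} (hk : 1 ≤ k) {a b : ℕ} (h : a ≤ b) :
    1 + Real.log ((k : ℝ) ^ a) ≤ 1 + Real.log ((k : ℝ) ^ b) := by
  have hk1 : (1 : ℝ) ≤ k := by exact_mod_cast hk
  have := Real.log_le_log (by positivity) (pow_le_pow_right₀ hk1 h)
  linarith

/-- `0 ≤ log k^a` for a natural `k`. [folklore] -/
theorem log_pow_natCast_nonneg (k a : ℕ) : 0 ≤ Real.log ((k : ℝ) ^ a) := by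
  rw [← Nat.cast_pow]; exact Real.log_natCast_nonneg _

/-! ## (62)–(63): the exceptional-set term with the parameters -/

/-- **The term `S · 8dR · scBound` of the chain** with `nB = C k^{4ρ}`, `μ₂ = μ + 2ρ`,
`μ₀ = μ − 2ρ − 2ρ'`, `R = k^ρ`, `S = k^{2ρ}`: multiplied by `k^{2ρ'} k^ρ` it is at most
`k^{3ρ+μ+ν} (16 d C k^ρ + 32 d C Λ (2D + 2 + Λ) + 64 d (1 + D))`
(`D = τ(k^{μ+2ρ})`, `Λ = 1 + log k^{μ+2ρ}`; the main term `16dC` is MR's `E₀`-term of (63)).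
[cite: MauduitRivat2015, (62)–(63), (86)] -/
theorem sc_term_le_mul {k : ℕ} (hk : 2 ≤ k) {μ ν ρ ρ' μ₀ : ℕ} (hμ₀ : μ₀ + 2 * ρ + 2 * ρ' = μ)
    (h1 : 5 * ρ + 2 * ρ' ≤ μ) (h2 : 7 * ρ + 2 * ρ' ≤ ν) (h3 : 2 * ρ' + ρ ≤ μ₀) (hρ : 1 ≤ ρ)
    {C d₀ : ℝ} (hC : 0 ≤ C) (hd : 0 ≤ d₀) {Mlen M₁ N : ℕ} (hMlen : Mlen ≤ k ^ μ) (hM₁ : M₁ = k ^ μ)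
    (hNle : N ≤ k ^ ν) :
    ((k ^ (2 * ρ) : ℕ) : ℝ) * (8 * d₀ * ((k ^ ρ : ℕ) : ℝ) *
        scBound k μ₀ (μ + 2 * ρ) (C * (k : ℝ) ^ (4 * ρ)) Mlen M₁ N) *
        ((k : ℝ) ^ (2 * ρ') * (k : ℝ) ^ ρ) ≤
      (k : ℝ) ^ (3 * ρ + μ + ν) *
        (16 * d₀ * C * (k : ℝ) ^ ρ +
          (32 * d₀ * C * (1 + Real.log ((k : ℝ) ^ (μ + 2 * ρ))) *
              (2 * ((k ^ (μ + 2 * ρ)).divisors.card : ℝ) + 2 + (1 + Real.log ((k : ℝ) ^ (μ + 2 * ρ)))) +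
            64 * d₀ * (1 + ((k ^ (μ + 2 * ρ)).divisors.card : ℝ)))) := by
  have hk0 : 0 < k := by omega
  have hk1 : 1 ≤ k := by omega
  have hq0 : (0 : ℝ) < k := by exact_mod_cast hk0
  set D : ℝ := ((k ^ (μ + 2 * ρ)).divisors.card : ℝ) with hD
  set Λ : ℝ := 1 + Real.log ((k : ℝ) ^ (μ + 2 * ρ)) with hΛ
  have hD0 : 0 ≤ D := Nat.cast_nonneg _
  have hΛ1 : 1 ≤ Λ := by have := log_pow_natCast_nonneg k (μ + 2 * ρ); rw [hΛ]; linarith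
  have hΛ0 : 0 ≤ Λ := by linarith
  -- the nat division `M₁ / k^{μ+2ρ} = 0`
  have hdiv : M₁ / k ^ (μ + 2 * ρ) = 0 := by
    rw [hM₁]; exact Nat.div_eq_of_lt (Nat.pow_lt_pow_right (by omega) (by omega))
  -- sizes
  have hMlenR : (Mlen : ℝ) ≤ (k : ℝ) ^ μ := by exact_mod_cast hMlen
  have hM₁R : (M₁ : ℝ) = (k : ℝ) ^ μ := by rw [hM₁]; push_cast; ring
  have hNR : (N : ℝ) ≤ (k : ℝ) ^ ν := by exact_mod_cast hNle
  have hτL : ((k ^ μ₀).divisors.card : ℝ) ≤ D := card_divisors_pow_le hk0 (by omega)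
  -- power identities
  have eμ : (k : ℝ) ^ μ = (k : ℝ) ^ μ₀ * (k : ℝ) ^ (2 * ρ) * (k : ℝ) ^ (2 * ρ') := by
    rw [← pow_add, ← pow_add, hμ₀]
  -- bound `scBound` by an expression in `k^μ`, `k^ν`
  have hsc : scBound k μ₀ (μ + 2 * ρ) (C * (k : ℝ) ^ (4 * ρ)) Mlen M₁ N ≤
      2 * ((k : ℝ) ^ μ₀ / (k : ℝ) ^ (μ + 2 * ρ) * (C * (k : ℝ) ^ (4 * ρ)) * (k : ℝ) ^ μ * (k : ℝ) ^ ν) +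
        4 * (C * (k : ℝ) ^ (4 * ρ)) * Λ *
          (2 * (k : ℝ) ^ ν * D + 2 * (k : ℝ) ^ μ₀ + (k : ℝ) ^ (μ + 2 * ρ) * Λ) +
        (2 * (k : ℝ) ^ μ * ((k : ℝ) ^ ν / (k : ℝ) ^ μ₀ + 3) +
          8 * D * (k : ℝ) ^ μ * (k : ℝ) ^ ν / (k : ℝ) ^ μ₀) := by
    unfold scBound
    simp only [hdiv, zero_add, Nat.cast_one, mul_one]
    push_cast
    rw [hM₁R]
    have hlog : 1 + Real.log ((k : ℝ) ^ (μ + 2 * ρ)) = Λ := rfl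
    rw [hlog]
    gcongr
  -- multiply out and compare monomials
  have key1 : 2 * ((k : ℝ) ^ μ₀ / (k : ℝ) ^ (μ + 2 * ρ) * (C * (k : ℝ) ^ (4 * ρ)) * (k : ℝ) ^ μ * (k : ℝ) ^ ν) *
      ((k : ℝ) ^ (2 * ρ') * (k : ℝ) ^ ρ) * ((k : ℝ) ^ (2 * ρ) * (8 * d₀ * (k : ℝ) ^ ρ)) =
      (k : ℝ) ^ (3 * ρ + μ + ν) * (16 * d₀ * C * (k : ℝ) ^ ρ) := by
    rw [pow_add (k : ℝ) μ (2 * ρ), pow_add (k : ℝ) (3 * ρ + μ) ν, pow_add (k : ℝ) (3 * ρ) μ, eμ]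
    field_simp
    ring
  have m1 : (k : ℝ) ^ (8 * ρ + 2 * ρ' + ν) ≤ (k : ℝ) ^ (3 * ρ + μ + ν) := kpow_le hk1 (by omega)
  have m2 : (k : ℝ) ^ (8 * ρ + 2 * ρ' + μ₀) ≤ (k : ℝ) ^ (3 * ρ + μ + ν) := kpow_le hk1 (by omega)
  have m3 : (k : ℝ) ^ (8 * ρ + 2 * ρ' + (μ + 2 * ρ)) ≤ (k : ℝ) ^ (3 * ρ + μ + ν) := kpow_le hk1 (by omega)
  have m4 : (k : ℝ) ^ (4 * ρ + 2 * ρ' + μ + ν) ≤ (k : ℝ) ^ (3 * ρ + μ + ν) * (k : ℝ) ^ μ₀ := by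
    rw [← pow_add]; exact kpow_le hk1 (by omega)
  have m5 : (k : ℝ) ^ (4 * ρ + 2 * ρ' + μ) ≤ (k : ℝ) ^ (3 * ρ + μ + ν) := kpow_le hk1 (by omega)
  -- the second group
  have key2 : 4 * (C * (k : ℝ) ^ (4 * ρ)) * Λ *
      (2 * (k : ℝ) ^ ν * D + 2 * (k : ℝ) ^ μ₀ + (k : ℝ) ^ (μ + 2 * ρ) * Λ) *
      ((k : ℝ) ^ (2 * ρ') * (k : ℝ) ^ ρ) * ((k : ℝ) ^ (2 * ρ) * (8 * d₀ * (k : ℝ) ^ ρ)) ≤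
      (k : ℝ) ^ (3 * ρ + μ + ν) * (32 * d₀ * C * Λ * (2 * D + 2 + Λ)) := by
    have e : 4 * (C * (k : ℝ) ^ (4 * ρ)) * Λ *
        (2 * (k : ℝ) ^ ν * D + 2 * (k : ℝ) ^ μ₀ + (k : ℝ) ^ (μ + 2 * ρ) * Λ) *
        ((k : ℝ) ^ (2 * ρ') * (k : ℝ) ^ ρ) * ((k : ℝ) ^ (2 * ρ) * (8 * d₀ * (k : ℝ) ^ ρ)) =
        32 * d₀ * C * Λ * (2 * D * (k : ℝ) ^ (8 * ρ + 2 * ρ' + ν) + 2 * (k : ℝ) ^ (8 * ρ + 2 * ρ' + μ₀) +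
          Λ * (k : ℝ) ^ (8 * ρ + 2 * ρ' + (μ + 2 * ρ))) := by ring
    rw [e]
    have hc : 0 ≤ 32 * d₀ * C * Λ := by positivity
    have : 2 * D * (k : ℝ) ^ (8 * ρ + 2 * ρ' + ν) + 2 * (k : ℝ) ^ (8 * ρ + 2 * ρ' + μ₀) +
        Λ * (k : ℝ) ^ (8 * ρ + 2 * ρ' + (μ + 2 * ρ)) ≤ (k : ℝ) ^ (3 * ρ + μ + ν) * (2 * D + 2 + Λ) := by
      have a1 := mul_le_mul_of_nonneg_left m1 (by positivity : 0 ≤ 2 * D)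
      have a3 := mul_le_mul_of_nonneg_left m3 hΛ0
      linarith
    calc 32 * d₀ * C * Λ * (2 * D * (k : ℝ) ^ (8 * ρ + 2 * ρ' + ν) + 2 * (k : ℝ) ^ (8 * ρ + 2 * ρ' + μ₀) +
          Λ * (k : ℝ) ^ (8 * ρ + 2 * ρ' + (μ + 2 * ρ)))
        ≤ 32 * d₀ * C * Λ * ((k : ℝ) ^ (3 * ρ + μ + ν) * (2 * D + 2 + Λ)) :=
          mul_le_mul_of_nonneg_left this hc
      _ = _ := by ring
  -- the third group
  have key3 : (2 * (k : ℝ) ^ μ * ((k : ℝ) ^ ν / (k : ℝ) ^ μ₀ + 3) +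
      8 * D * (k : ℝ) ^ μ * (k : ℝ) ^ ν / (k : ℝ) ^ μ₀) *
      ((k : ℝ) ^ (2 * ρ') * (k : ℝ) ^ ρ) * ((k : ℝ) ^ (2 * ρ) * (8 * d₀ * (k : ℝ) ^ ρ)) ≤
      (k : ℝ) ^ (3 * ρ + μ + ν) * (64 * d₀ * (1 + D)) := by
    have hL0 : (0 : ℝ) < (k : ℝ) ^ μ₀ := by positivity
    have e : (2 * (k : ℝ) ^ μ * ((k : ℝ) ^ ν / (k : ℝ) ^ μ₀ + 3) +
        8 * D * (k : ℝ) ^ μ * (k : ℝ) ^ ν / (k : ℝ) ^ μ₀) *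
        ((k : ℝ) ^ (2 * ρ') * (k : ℝ) ^ ρ) * ((k : ℝ) ^ (2 * ρ) * (8 * d₀ * (k : ℝ) ^ ρ)) =
        (16 * d₀ + 64 * d₀ * D) * ((k : ℝ) ^ (4 * ρ + 2 * ρ' + μ + ν) / (k : ℝ) ^ μ₀) +
          48 * d₀ * (k : ℝ) ^ (4 * ρ + 2 * ρ' + μ) := by
      field_simp
      ring
    rw [e]
    have hfrac : (k : ℝ) ^ (4 * ρ + 2 * ρ' + μ + ν) / (k : ℝ) ^ μ₀ ≤ (k : ℝ) ^ (3 * ρ + μ + ν) := by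
      rw [div_le_iff₀ hL0]; exact m4
    have hc : 0 ≤ 16 * d₀ + 64 * d₀ * D := by positivity
    have a1 := mul_le_mul_of_nonneg_left hfrac hc
    have a2 := mul_le_mul_of_nonneg_left m5 (by positivity : 0 ≤ 48 * d₀)
    linarith
  -- combine
  have hfac : 0 ≤ ((k : ℝ) ^ (2 * ρ') * (k : ℝ) ^ ρ) * ((k : ℝ) ^ (2 * ρ) * (8 * d₀ * (k : ℝ) ^ ρ)) := by
    positivity
  have htot := mul_le_mul_of_nonneg_right hsc hfac
  have eLHS : ((k ^ (2 * ρ) : ℕ) : ℝ) * (8 * d₀ * ((k ^ ρ : ℕ) : ℝ) *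
      scBound k μ₀ (μ + 2 * ρ) (C * (k : ℝ) ^ (4 * ρ)) Mlen M₁ N) * ((k : ℝ) ^ (2 * ρ') * (k : ℝ) ^ ρ) =
      scBound k μ₀ (μ + 2 * ρ) (C * (k : ℝ) ^ (4 * ρ)) Mlen M₁ N *
        (((k : ℝ) ^ (2 * ρ') * (k : ℝ) ^ ρ) * ((k : ℝ) ^ (2 * ρ) * (8 * d₀ * (k : ℝ) ^ ρ))) := by
    push_cast; ring
  rw [eLHS]
  refine htot.trans ?_
  have esplit : (2 * ((k : ℝ) ^ μ₀ / (k : ℝ) ^ (μ + 2 * ρ) * (C * (k : ℝ) ^ (4 * ρ)) * (k : ℝ) ^ μ * (k : ℝ) ^ ν) +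
        4 * (C * (k : ℝ) ^ (4 * ρ)) * Λ *
          (2 * (k : ℝ) ^ ν * D + 2 * (k : ℝ) ^ μ₀ + (k : ℝ) ^ (μ + 2 * ρ) * Λ) +
        (2 * (k : ℝ) ^ μ * ((k : ℝ) ^ ν / (k : ℝ) ^ μ₀ + 3) +
          8 * D * (k : ℝ) ^ μ * (k : ℝ) ^ ν / (k : ℝ) ^ μ₀)) *
      (((k : ℝ) ^ (2 * ρ') * (k : ℝ) ^ ρ) * ((k : ℝ) ^ (2 * ρ) * (8 * d₀ * (k : ℝ) ^ ρ))) =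
      2 * ((k : ℝ) ^ μ₀ / (k : ℝ) ^ (μ + 2 * ρ) * (C * (k : ℝ) ^ (4 * ρ)) * (k : ℝ) ^ μ * (k : ℝ) ^ ν) *
        ((k : ℝ) ^ (2 * ρ') * (k : ℝ) ^ ρ) * ((k : ℝ) ^ (2 * ρ) * (8 * d₀ * (k : ℝ) ^ ρ)) +
      4 * (C * (k : ℝ) ^ (4 * ρ)) * Λ *
        (2 * (k : ℝ) ^ ν * D + 2 * (k : ℝ) ^ μ₀ + (k : ℝ) ^ (μ + 2 * ρ) * Λ) *
        ((k : ℝ) ^ (2 * ρ') * (k : ℝ) ^ ρ) * ((k : ℝ) ^ (2 * ρ) * (8 * d₀ * (k : ℝ) ^ ρ)) +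
      (2 * (k : ℝ) ^ μ * ((k : ℝ) ^ ν / (k : ℝ) ^ μ₀ + 3) +
        8 * D * (k : ℝ) ^ μ * (k : ℝ) ^ ν / (k : ℝ) ^ μ₀) *
        ((k : ℝ) ^ (2 * ρ') * (k : ℝ) ^ ρ) * ((k : ℝ) ^ (2 * ρ) * (8 * d₀ * (k : ℝ) ^ ρ)) := by ring
  rw [esplit, key1]
  refine (add_le_add (add_le_add le_rfl key2) key3).trans (le_of_eq ?_)
  ring

/-- `k^A ≤ k^B / k^e` for `A + e ≤ B`. [folklore] -/
theorem kpow_le_div {k : ℕ} (hk : 1 ≤ k) {A B e : ℕ} (h : A + e ≤ B) :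
    (k : ℝ) ^ A ≤ (k : ℝ) ^ B / (k : ℝ) ^ e := by
  have hk0 : (0 : ℝ) < k := by exact_mod_cast (show 0 < k by omega)
  rw [le_div_iff₀ (pow_pos hk0 _), ← pow_add]
  exact kpow_le hk h

/-- `k^A ≤ k^B / k^e₁ / k^e₂` for `A + e₁ + e₂ ≤ B`. [folklore] -/
theorem kpow_le_div₂ {k : ℕ} (hk : 1 ≤ k) {A B e₁ e₂ : ℕ} (h : A + e₁ + e₂ ≤ B) :
    (k : ℝ) ^ A ≤ (k : ℝ) ^ B / (k : ℝ) ^ e₁ / (k : ℝ) ^ e₂ := by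
  have hk0 : (0 : ℝ) < k := by exact_mod_cast (show 0 < k by omega)
  rw [le_div_iff₀ (pow_pos hk0 _), le_div_iff₀ (pow_pos hk0 _), ← pow_add, ← pow_add]
  exact kpow_le hk (by omega)

/-- Divided form of `sc_term_le_mul`:
`S·8dR·scBound ≤ k^{3ρ+μ+ν}/k^{2ρ'} · (16dC + (32dCΛ(2D+2+Λ) + 64d(1+D))/k^ρ)`.
[cite: MauduitRivat2015, (62)–(63), (86)] -/
theorem sc_term_le {k : ℕ} (hk : 2 ≤ k) {μ ν ρ ρ' μ₀ : ℕ} (hμ₀ : μ₀ + 2 * ρ + 2 * ρ' = μ)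
    (h1 : 5 * ρ + 2 * ρ' ≤ μ) (h2 : 7 * ρ + 2 * ρ' ≤ ν) (h3 : 2 * ρ' + ρ ≤ μ₀) (hρ : 1 ≤ ρ)
    {C d₀ : ℝ} (hC : 0 ≤ C) (hd : 0 ≤ d₀) {Mlen M₁ N : ℕ} (hMlen : Mlen ≤ k ^ μ) (hM₁ : M₁ = k ^ μ)
    (hNle : N ≤ k ^ ν) :
    ((k ^ (2 * ρ) : ℕ) : ℝ) * (8 * d₀ * ((k ^ ρ : ℕ) : ℝ) *
        scBound k μ₀ (μ + 2 * ρ) (C * (k : ℝ) ^ (4 * ρ)) Mlen M₁ N) ≤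
      (k : ℝ) ^ (3 * ρ + μ + ν) / (k : ℝ) ^ (2 * ρ') *
        (16 * d₀ * C +
          (32 * d₀ * C * (1 + Real.log ((k : ℝ) ^ (μ + 2 * ρ))) *
              (2 * ((k ^ (μ + 2 * ρ)).divisors.card : ℝ) + 2 + (1 + Real.log ((k : ℝ) ^ (μ + 2 * ρ)))) +
            64 * d₀ * (1 + ((k ^ (μ + 2 * ρ)).divisors.card : ℝ))) / (k : ℝ) ^ ρ) := by
  have hk0 : (0 : ℝ) < k := by exact_mod_cast (show 0 < k by omega)
  have h := sc_term_le_mul hk hμ₀ h1 h2 h3 hρ hC hd hMlen hM₁ hNle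
  have hpos : (0 : ℝ) < (k : ℝ) ^ (2 * ρ') * (k : ℝ) ^ ρ := by positivity
  rw [← le_div_iff₀ hpos] at h
  refine h.trans (le_of_eq ?_)
  field_simp

/-! ## (64)–(70): the smoothing term with the parameters -/

/-- **The term `S · 4dR · (sharp smoothing bound)` of the chain** with `H = k^{4ρ+6ρ'}`,
`w = μ₀ − 2ρ'`, `μ₂ = μ + 2ρ`, `R = k^ρ`, `S = k^{2ρ}`:
`≤ k^{3ρ+μ+ν}/k^{2ρ'} · (20d + (64dΛ(2D+2+Λ) + 32d(1+D))/k^ρ)`.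
[cite: MauduitRivat2015, (64)–(70), (86)] -/
theorem sms_term_le {k : ℕ} (hk : 2 ≤ k) {μ ν ρ ρ' μ₀ w : ℕ} (hμ₀ : μ₀ + 2 * ρ + 2 * ρ' = μ)
    (hw : w + 2 * ρ' = μ₀) (h1 : 3 * ρ + 4 * ρ' ≤ μ) (h2 : ρ + 2 * ρ' ≤ ν) (h3 : 4 * ρ' + ρ ≤ μ₀)
    (hρ : 1 ≤ ρ) {d₀ : ℝ} (hd : 0 ≤ d₀) {Mlen M₁ Nlen : ℕ} (hMlen : Mlen ≤ k ^ μ)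
    (hM₁ : M₁ = k ^ μ) (hNle : Nlen ≤ k ^ ν) :
    ((k ^ (2 * ρ) : ℕ) : ℝ) * (4 * d₀ * ((k ^ ρ : ℕ) : ℝ) *
        ((2 * (((k ^ w : ℕ) : ℝ) / (k ^ μ₀ : ℕ) * 2 * (Mlen : ℝ) * (Nlen : ℝ)) +
            4 * 2 * ((M₁ / k ^ μ₀ + 1 : ℕ) : ℝ) * (1 + Real.log ((k ^ μ₀ : ℕ) : ℝ)) *
              (2 * (Nlen : ℝ) * ((k ^ μ₀).divisors.card : ℝ) + 2 * (k ^ w : ℕ) +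
                (k ^ μ₀ : ℕ) * (1 + Real.log ((k ^ μ₀ : ℕ) : ℝ))) +
            (2 * (Mlen : ℝ) * ((Nlen : ℝ) / (k ^ w : ℕ) + 3) +
              8 * ((k ^ w).divisors.card : ℝ) * M₁ * (Nlen : ℝ) / (k ^ w : ℕ))) +
          (k ^ (μ + 2 * ρ) : ℝ) / ((k ^ (4 * ρ + 6 * ρ') : ℕ) : ℝ) / (k ^ w : ℕ) *
            ((Mlen : ℝ) * (Nlen : ℝ)))) ≤
      (k : ℝ) ^ (3 * ρ + μ + ν) / (k : ℝ) ^ (2 * ρ') *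
        (20 * d₀ +
          (64 * d₀ * (1 + Real.log ((k : ℝ) ^ (μ + 2 * ρ))) *
              (2 * ((k ^ (μ + 2 * ρ)).divisors.card : ℝ) + 2 + (1 + Real.log ((k : ℝ) ^ (μ + 2 * ρ)))) +
            32 * d₀ * (1 + ((k ^ (μ + 2 * ρ)).divisors.card : ℝ))) / (k : ℝ) ^ ρ) := by
  have hk0' : 0 < k := by omega
  have hk1 : 1 ≤ k := by omega
  have hk0 : (0 : ℝ) < k := by exact_mod_cast hk0'
  set D : ℝ := ((k ^ (μ + 2 * ρ)).divisors.card : ℝ) with hD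
  set Λ : ℝ := 1 + Real.log ((k : ℝ) ^ (μ + 2 * ρ)) with hΛ
  have hD0 : 0 ≤ D := Nat.cast_nonneg _
  have hΛ1 : 1 ≤ Λ := by have := log_pow_natCast_nonneg k (μ + 2 * ρ); rw [hΛ]; linarith
  have hΛ0 : 0 ≤ Λ := by linarith
  -- the nat division `M₁ / k^{μ₀} = k^{2ρ+2ρ'}`
  have hdiv : M₁ / k ^ μ₀ = k ^ (2 * ρ + 2 * ρ') := by
    rw [hM₁, Nat.pow_div (by omega) hk0']; congr 1; omega
  -- sizes
  have hMlenR : (Mlen : ℝ) ≤ (k : ℝ) ^ μ := by exact_mod_cast hMlen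
  have hM₁R : (M₁ : ℝ) = (k : ℝ) ^ μ := by rw [hM₁]; push_cast; ring
  have hNR : (Nlen : ℝ) ≤ (k : ℝ) ^ ν := by exact_mod_cast hNle
  have hτL : ((k ^ μ₀).divisors.card : ℝ) ≤ D := card_divisors_pow_le hk0' (by omega)
  have hτw : ((k ^ w).divisors.card : ℝ) ≤ D := card_divisors_pow_le hk0' (by omega)
  have hlogL : 1 + Real.log ((k : ℝ) ^ μ₀) ≤ Λ := one_add_log_pow_le hk1 (by omega)
  have hlogL0 : 0 ≤ 1 + Real.log ((k : ℝ) ^ μ₀) := by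
    have := log_pow_natCast_nonneg k μ₀; linarith
  have hper : ((k ^ (2 * ρ + 2 * ρ') + 1 : ℕ) : ℝ) ≤ 2 * (k : ℝ) ^ (2 * ρ + 2 * ρ') := by
    have : (1 : ℝ) ≤ (k : ℝ) ^ (2 * ρ + 2 * ρ') := one_le_pow₀ (by exact_mod_cast hk1)
    push_cast; linarith
  -- bound the bracket by an expression in powers of `k`
  have hsm : (2 * (((k ^ w : ℕ) : ℝ) / (k ^ μ₀ : ℕ) * 2 * (Mlen : ℝ) * (Nlen : ℝ)) +
        4 * 2 * ((M₁ / k ^ μ₀ + 1 : ℕ) : ℝ) * (1 + Real.log ((k ^ μ₀ : ℕ) : ℝ)) *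
          (2 * (Nlen : ℝ) * ((k ^ μ₀).divisors.card : ℝ) + 2 * (k ^ w : ℕ) +
            (k ^ μ₀ : ℕ) * (1 + Real.log ((k ^ μ₀ : ℕ) : ℝ))) +
        (2 * (Mlen : ℝ) * ((Nlen : ℝ) / (k ^ w : ℕ) + 3) +
          8 * ((k ^ w).divisors.card : ℝ) * M₁ * (Nlen : ℝ) / (k ^ w : ℕ))) +
      (k ^ (μ + 2 * ρ) : ℝ) / ((k ^ (4 * ρ + 6 * ρ') : ℕ) : ℝ) / (k ^ w : ℕ) * ((Mlen : ℝ) * (Nlen : ℝ)) ≤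
      (2 * ((k : ℝ) ^ w / (k : ℝ) ^ μ₀ * 2 * (k : ℝ) ^ μ * (k : ℝ) ^ ν) +
        4 * 2 * (2 * (k : ℝ) ^ (2 * ρ + 2 * ρ')) * Λ *
          (2 * (k : ℝ) ^ ν * D + 2 * (k : ℝ) ^ w + (k : ℝ) ^ μ₀ * Λ) +
        (2 * (k : ℝ) ^ μ * ((k : ℝ) ^ ν / (k : ℝ) ^ w + 3) +
          8 * D * (k : ℝ) ^ μ * (k : ℝ) ^ ν / (k : ℝ) ^ w)) +
      (k : ℝ) ^ (μ + 2 * ρ) / (k : ℝ) ^ (4 * ρ + 6 * ρ') / (k : ℝ) ^ w * ((k : ℝ) ^ μ * (k : ℝ) ^ ν) := by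
    rw [hdiv]
    push_cast
    rw [hM₁R]
    push_cast at hper
    gcongr
  -- power identities
  have eμ : (k : ℝ) ^ μ = (k : ℝ) ^ w * (k : ℝ) ^ (2 * ρ') * (k : ℝ) ^ (2 * ρ) * (k : ℝ) ^ (2 * ρ') := by
    rw [← pow_add, ← pow_add, ← pow_add]; congr 1; omega
  have eμ₀ : (k : ℝ) ^ μ₀ = (k : ℝ) ^ w * (k : ℝ) ^ (2 * ρ') := by rw [← pow_add, hw]
  set F : ℝ := ((k ^ (2 * ρ) : ℕ) : ℝ) * (4 * d₀ * ((k ^ ρ : ℕ) : ℝ)) with hF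
  have hF0 : 0 ≤ F := by positivity
  have hFe : F = 4 * d₀ * (k : ℝ) ^ (3 * ρ) := by
    rw [hF]; push_cast; ring
  -- target pieces
  have hQpos : (0 : ℝ) < (k : ℝ) ^ (3 * ρ + μ + ν) / (k : ℝ) ^ (2 * ρ') := by positivity
  -- U1 and U4 (exact)
  have key1 : F * (2 * ((k : ℝ) ^ w / (k : ℝ) ^ μ₀ * 2 * (k : ℝ) ^ μ * (k : ℝ) ^ ν)) =
      (k : ℝ) ^ (3 * ρ + μ + ν) / (k : ℝ) ^ (2 * ρ') * (16 * d₀) := by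
    rw [hFe, eμ₀, pow_add (k : ℝ) (3 * ρ + μ) ν, pow_add (k : ℝ) (3 * ρ) μ]
    field_simp
    ring
  have key4 : F * ((k : ℝ) ^ (μ + 2 * ρ) / (k : ℝ) ^ (4 * ρ + 6 * ρ') / (k : ℝ) ^ w * ((k : ℝ) ^ μ * (k : ℝ) ^ ν)) =
      (k : ℝ) ^ (3 * ρ + μ + ν) / (k : ℝ) ^ (2 * ρ') * (4 * d₀) := by
    rw [hFe, pow_add (k : ℝ) (3 * ρ + μ) ν, pow_add (k : ℝ) (3 * ρ) μ, pow_add (k : ℝ) μ (2 * ρ),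
      pow_add (k : ℝ) (4 * ρ) (6 * ρ'), eμ]
    field_simp
    ring
  -- U2
  have m1 : (k : ℝ) ^ (5 * ρ + 2 * ρ' + ν) ≤ (k : ℝ) ^ (3 * ρ + μ + ν) / (k : ℝ) ^ (2 * ρ') / (k : ℝ) ^ ρ :=
    kpow_le_div₂ hk1 (by omega)
  have m2 : (k : ℝ) ^ (5 * ρ + 2 * ρ' + w) ≤ (k : ℝ) ^ (3 * ρ + μ + ν) / (k : ℝ) ^ (2 * ρ') / (k : ℝ) ^ ρ :=
    kpow_le_div₂ hk1 (by omega)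
  have m3 : (k : ℝ) ^ (5 * ρ + 2 * ρ' + μ₀) ≤ (k : ℝ) ^ (3 * ρ + μ + ν) / (k : ℝ) ^ (2 * ρ') / (k : ℝ) ^ ρ :=
    kpow_le_div₂ hk1 (by omega)
  have key2 : F * (4 * 2 * (2 * (k : ℝ) ^ (2 * ρ + 2 * ρ')) * Λ *
      (2 * (k : ℝ) ^ ν * D + 2 * (k : ℝ) ^ w + (k : ℝ) ^ μ₀ * Λ)) ≤
      (k : ℝ) ^ (3 * ρ + μ + ν) / (k : ℝ) ^ (2 * ρ') / (k : ℝ) ^ ρ * (64 * d₀ * Λ * (2 * D + 2 + Λ)) := by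
    have e : F * (4 * 2 * (2 * (k : ℝ) ^ (2 * ρ + 2 * ρ')) * Λ *
        (2 * (k : ℝ) ^ ν * D + 2 * (k : ℝ) ^ w + (k : ℝ) ^ μ₀ * Λ)) =
        64 * d₀ * Λ * (2 * D * (k : ℝ) ^ (5 * ρ + 2 * ρ' + ν) + 2 * (k : ℝ) ^ (5 * ρ + 2 * ρ' + w) +
          Λ * (k : ℝ) ^ (5 * ρ + 2 * ρ' + μ₀)) := by rw [hFe]; ring
    rw [e]
    have a1 := mul_le_mul_of_nonneg_left m1 (by positivity : 0 ≤ 2 * D)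
    have a3 := mul_le_mul_of_nonneg_left m3 hΛ0
    have : 2 * D * (k : ℝ) ^ (5 * ρ + 2 * ρ' + ν) + 2 * (k : ℝ) ^ (5 * ρ + 2 * ρ' + w) +
        Λ * (k : ℝ) ^ (5 * ρ + 2 * ρ' + μ₀) ≤
        (k : ℝ) ^ (3 * ρ + μ + ν) / (k : ℝ) ^ (2 * ρ') / (k : ℝ) ^ ρ * (2 * D + 2 + Λ) := by linarith
    calc 64 * d₀ * Λ * (2 * D * (k : ℝ) ^ (5 * ρ + 2 * ρ' + ν) + 2 * (k : ℝ) ^ (5 * ρ + 2 * ρ' + w) +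
          Λ * (k : ℝ) ^ (5 * ρ + 2 * ρ' + μ₀))
        ≤ 64 * d₀ * Λ * ((k : ℝ) ^ (3 * ρ + μ + ν) / (k : ℝ) ^ (2 * ρ') / (k : ℝ) ^ ρ * (2 * D + 2 + Λ)) :=
          mul_le_mul_of_nonneg_left this (by positivity)
      _ = _ := by ring
  -- U3
  have m4 : (k : ℝ) ^ (3 * ρ + μ + ν) / (k : ℝ) ^ w ≤
      (k : ℝ) ^ (3 * ρ + μ + ν) / (k : ℝ) ^ (2 * ρ') / (k : ℝ) ^ ρ := by
    rw [div_div]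
    refine div_le_div_of_nonneg_left (by positivity) (by positivity) ?_
    rw [← pow_add]; exact kpow_le hk1 (by omega)
  have m5 : (k : ℝ) ^ (3 * ρ + μ) ≤ (k : ℝ) ^ (3 * ρ + μ + ν) / (k : ℝ) ^ (2 * ρ') / (k : ℝ) ^ ρ :=
    kpow_le_div₂ hk1 (by omega)
  have key3 : F * (2 * (k : ℝ) ^ μ * ((k : ℝ) ^ ν / (k : ℝ) ^ w + 3) +
      8 * D * (k : ℝ) ^ μ * (k : ℝ) ^ ν / (k : ℝ) ^ w) ≤
      (k : ℝ) ^ (3 * ρ + μ + ν) / (k : ℝ) ^ (2 * ρ') / (k : ℝ) ^ ρ * (32 * d₀ * (1 + D)) := by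
    have e : F * (2 * (k : ℝ) ^ μ * ((k : ℝ) ^ ν / (k : ℝ) ^ w + 3) +
        8 * D * (k : ℝ) ^ μ * (k : ℝ) ^ ν / (k : ℝ) ^ w) =
        (8 * d₀ + 32 * d₀ * D) * ((k : ℝ) ^ (3 * ρ + μ + ν) / (k : ℝ) ^ w) + 24 * d₀ * (k : ℝ) ^ (3 * ρ + μ) := by
      rw [hFe, pow_add (k : ℝ) (3 * ρ + μ) ν, pow_add (k : ℝ) (3 * ρ) μ]
      field_simp
      ring
    rw [e]
    have a1 := mul_le_mul_of_nonneg_left m4 (by positivity : 0 ≤ 8 * d₀ + 32 * d₀ * D)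
    have a2 := mul_le_mul_of_nonneg_left m5 (by positivity : 0 ≤ 24 * d₀)
    linarith
  -- combine
  have htot := mul_le_mul_of_nonneg_left hsm hF0
  have eL : ((k ^ (2 * ρ) : ℕ) : ℝ) * (4 * d₀ * ((k ^ ρ : ℕ) : ℝ) *
      ((2 * (((k ^ w : ℕ) : ℝ) / (k ^ μ₀ : ℕ) * 2 * (Mlen : ℝ) * (Nlen : ℝ)) +
          4 * 2 * ((M₁ / k ^ μ₀ + 1 : ℕ) : ℝ) * (1 + Real.log ((k ^ μ₀ : ℕ) : ℝ)) *
            (2 * (Nlen : ℝ) * ((k ^ μ₀).divisors.card : ℝ) + 2 * (k ^ w : ℕ) +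
              (k ^ μ₀ : ℕ) * (1 + Real.log ((k ^ μ₀ : ℕ) : ℝ))) +
          (2 * (Mlen : ℝ) * ((Nlen : ℝ) / (k ^ w : ℕ) + 3) +
            8 * ((k ^ w).divisors.card : ℝ) * M₁ * (Nlen : ℝ) / (k ^ w : ℕ))) +
        (k ^ (μ + 2 * ρ) : ℝ) / ((k ^ (4 * ρ + 6 * ρ') : ℕ) : ℝ) / (k ^ w : ℕ) *
          ((Mlen : ℝ) * (Nlen : ℝ)))) =
      F * ((2 * (((k ^ w : ℕ) : ℝ) / (k ^ μ₀ : ℕ) * 2 * (Mlen : ℝ) * (Nlen : ℝ)) +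
          4 * 2 * ((M₁ / k ^ μ₀ + 1 : ℕ) : ℝ) * (1 + Real.log ((k ^ μ₀ : ℕ) : ℝ)) *
            (2 * (Nlen : ℝ) * ((k ^ μ₀).divisors.card : ℝ) + 2 * (k ^ w : ℕ) +
              (k ^ μ₀ : ℕ) * (1 + Real.log ((k ^ μ₀ : ℕ) : ℝ))) +
          (2 * (Mlen : ℝ) * ((Nlen : ℝ) / (k ^ w : ℕ) + 3) +
            8 * ((k ^ w).divisors.card : ℝ) * M₁ * (Nlen : ℝ) / (k ^ w : ℕ))) +
        (k ^ (μ + 2 * ρ) : ℝ) / ((k ^ (4 * ρ + 6 * ρ') : ℕ) : ℝ) / (k ^ w : ℕ) *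
          ((Mlen : ℝ) * (Nlen : ℝ))) := by rw [hF]; ring
  rw [eL]
  refine htot.trans ?_
  have esplit : F * ((2 * ((k : ℝ) ^ w / (k : ℝ) ^ μ₀ * 2 * (k : ℝ) ^ μ * (k : ℝ) ^ ν) +
        4 * 2 * (2 * (k : ℝ) ^ (2 * ρ + 2 * ρ')) * Λ *
          (2 * (k : ℝ) ^ ν * D + 2 * (k : ℝ) ^ w + (k : ℝ) ^ μ₀ * Λ) +
        (2 * (k : ℝ) ^ μ * ((k : ℝ) ^ ν / (k : ℝ) ^ w + 3) +
          8 * D * (k : ℝ) ^ μ * (k : ℝ) ^ ν / (k : ℝ) ^ w)) +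
      (k : ℝ) ^ (μ + 2 * ρ) / (k : ℝ) ^ (4 * ρ + 6 * ρ') / (k : ℝ) ^ w * ((k : ℝ) ^ μ * (k : ℝ) ^ ν)) =
      F * (2 * ((k : ℝ) ^ w / (k : ℝ) ^ μ₀ * 2 * (k : ℝ) ^ μ * (k : ℝ) ^ ν)) +
      F * (4 * 2 * (2 * (k : ℝ) ^ (2 * ρ + 2 * ρ')) * Λ *
          (2 * (k : ℝ) ^ ν * D + 2 * (k : ℝ) ^ w + (k : ℝ) ^ μ₀ * Λ)) +
      F * (2 * (k : ℝ) ^ μ * ((k : ℝ) ^ ν / (k : ℝ) ^ w + 3) +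
          8 * D * (k : ℝ) ^ μ * (k : ℝ) ^ ν / (k : ℝ) ^ w) +
      F * ((k : ℝ) ^ (μ + 2 * ρ) / (k : ℝ) ^ (4 * ρ + 6 * ρ') / (k : ℝ) ^ w * ((k : ℝ) ^ μ * (k : ℝ) ^ ν)) := by
    ring
  rw [esplit, key1, key4]
  refine (add_le_add (add_le_add (add_le_add le_rfl key2) key3) le_rfl).trans (le_of_eq ?_)
  field_simp
  ring

/-! ## (85): the off-diagonal term with the parameters -/

/-- **The term `∑_s∑_r |S₄''(r,s)|` of the chain** bounded by `norm_corrS4rOff_le_n` with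
`H = k^{4ρ+6ρ'}`, `μ₂ = μ + 2ρ`, `μ₀ = μ − 2ρ − 2ρ'`, summed over `r < k^ρ`, `s < k^{2ρ}`:
`≤ k^{3ρ+μ+ν}/k^{2ρ'} · d²(1+Λ)²(4+Λ)/k^ρ` provided `13ρ + 12ρ' ≤ μ` and `11ρ + 6ρ' ≤ ν`.
[cite: MauduitRivat2015, (85), (86), (89)] -/
theorem off_term_le {k : ℕ} (hk : 2 ≤ k) {μ ν ρ ρ' μ₀ : ℕ} (hμ₀ : μ₀ + 2 * ρ + 2 * ρ' = μ)
    (h1 : 13 * ρ + 12 * ρ' ≤ μ) (h2 : 11 * ρ + 6 * ρ' ≤ ν) (hρ : 1 ≤ ρ) {dn : ℕ} {M₁ Nlen : ℕ}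
    (hM₁ : M₁ = k ^ μ) (hNle : Nlen ≤ k ^ ν) {X : ℕ → ℕ → ℝ}
    (hX : ∀ r s, X r s ≤
      (((k ^ (μ + 2 * ρ - μ₀) : ℕ) : ℝ) * (k ^ (μ + 2 * ρ - μ₀) : ℕ)) *
        (((k ^ μ₀ : ℕ) : ℝ) / (k ^ (μ + 2 * ρ) : ℕ) + (1 + Real.log ((k ^ (4 * ρ + 6 * ρ') : ℕ) : ℝ))) ^ 2 *
          ((dn : ℝ) ^ 2 * (((M₁ / k ^ (μ + 2 * ρ) + 1 : ℕ) : ℝ) *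
            (2 * ((2 * k ^ (4 * ρ + 6 * ρ') : ℕ) : ℝ) * (Nlen : ℝ) +
              (k ^ (μ + 2 * ρ) : ℕ) * (1 + Real.log ((k ^ (μ + 2 * ρ) : ℕ) : ℝ)))))) :
    ∑ s ∈ Ico 1 (k ^ (2 * ρ)), ∑ r ∈ Ico 1 (k ^ ρ), X r s ≤
      (k : ℝ) ^ (3 * ρ + μ + ν) / (k : ℝ) ^ (2 * ρ') *
        ((dn : ℝ) ^ 2 * (1 + (1 + Real.log ((k : ℝ) ^ (μ + 2 * ρ)))) ^ 2 *
          (4 + (1 + Real.log ((k : ℝ) ^ (μ + 2 * ρ)))) / (k : ℝ) ^ ρ) := by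
  have hk0' : 0 < k := by omega
  have hk1 : 1 ≤ k := by omega
  have hk0 : (0 : ℝ) < k := by exact_mod_cast hk0'
  set Λ : ℝ := 1 + Real.log ((k : ℝ) ^ (μ + 2 * ρ)) with hΛ
  have hΛ1 : 1 ≤ Λ := by have := log_pow_natCast_nonneg k (μ + 2 * ρ); rw [hΛ]; linarith
  have hΛ0 : 0 ≤ Λ := by linarith
  have hsub : μ + 2 * ρ - μ₀ = 4 * ρ + 2 * ρ' := by omega
  have hdiv : M₁ / k ^ (μ + 2 * ρ) = 0 := by
    rw [hM₁]; exact Nat.div_eq_of_lt (Nat.pow_lt_pow_right (by omega) (by omega))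
  have hNR : (Nlen : ℝ) ≤ (k : ℝ) ^ ν := by exact_mod_cast hNle
  have hlogH : 1 + Real.log ((k : ℝ) ^ (4 * ρ + 6 * ρ')) ≤ Λ := one_add_log_pow_le hk1 (by omega)
  have hfrac : (k : ℝ) ^ μ₀ / (k : ℝ) ^ (μ + 2 * ρ) ≤ 1 := by
    rw [div_le_one (by positivity)]; exact kpow_le hk1 (by omega)
  have hbr : (k : ℝ) ^ μ₀ / (k : ℝ) ^ (μ + 2 * ρ) + (1 + Real.log ((k : ℝ) ^ (4 * ρ + 6 * ρ'))) ≤ 1 + Λ := by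
    linarith
  have hbr0 : 0 ≤ (k : ℝ) ^ μ₀ / (k : ℝ) ^ (μ + 2 * ρ) + (1 + Real.log ((k : ℝ) ^ (4 * ρ + 6 * ρ'))) := by
    have := log_pow_natCast_nonneg k (4 * ρ + 6 * ρ'); positivity
  -- the bound for each `(r, s)`
  have hrs : ∀ r s, X r s ≤ (k : ℝ) ^ (8 * ρ + 4 * ρ') * (1 + Λ) ^ 2 *
      ((dn : ℝ) ^ 2 * (4 * (k : ℝ) ^ (4 * ρ + 6 * ρ') * (k : ℝ) ^ ν + (k : ℝ) ^ (μ + 2 * ρ) * Λ)) := by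
    intro r s
    refine (hX r s).trans ?_
    rw [hsub, hdiv]
    push_cast
    have e8 : (k : ℝ) ^ (4 * ρ + 2 * ρ') * (k : ℝ) ^ (4 * ρ + 2 * ρ') = (k : ℝ) ^ (8 * ρ + 4 * ρ') := by
      rw [← pow_add]; congr 1; omega
    rw [e8]
    have hlog' : 1 + Real.log ((k : ℝ) ^ (μ + 2 * ρ)) = Λ := rfl
    rw [hlog']
    have hsq : ((k : ℝ) ^ μ₀ / (k : ℝ) ^ (μ + 2 * ρ) + (1 + Real.log ((k : ℝ) ^ (4 * ρ + 6 * ρ')))) ^ 2 ≤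
        (1 + Λ) ^ 2 := pow_le_pow_left₀ hbr0 hbr 2
    have hin : 1 * (2 * (2 * (k : ℝ) ^ (4 * ρ + 6 * ρ')) * (Nlen : ℝ) + (k : ℝ) ^ (μ + 2 * ρ) * Λ) ≤
        4 * (k : ℝ) ^ (4 * ρ + 6 * ρ') * (k : ℝ) ^ ν + (k : ℝ) ^ (μ + 2 * ρ) * Λ := by
      have := mul_le_mul_of_nonneg_left hNR (by positivity : 0 ≤ 4 * (k : ℝ) ^ (4 * ρ + 6 * ρ'))
      linarith
    have hin0 : 0 ≤ 1 * (2 * (2 * (k : ℝ) ^ (4 * ρ + 6 * ρ')) * (Nlen : ℝ) + (k : ℝ) ^ (μ + 2 * ρ) * Λ) := by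
      positivity
    gcongr
  -- sum over `(r, s)`
  have hsum : ∑ s ∈ Ico 1 (k ^ (2 * ρ)), ∑ r ∈ Ico 1 (k ^ ρ), X r s ≤
      (k : ℝ) ^ (2 * ρ) * ((k : ℝ) ^ ρ * ((k : ℝ) ^ (8 * ρ + 4 * ρ') * (1 + Λ) ^ 2 *
        ((dn : ℝ) ^ 2 * (4 * (k : ℝ) ^ (4 * ρ + 6 * ρ') * (k : ℝ) ^ ν + (k : ℝ) ^ (μ + 2 * ρ) * Λ)))) := by
    have hC0 : 0 ≤ (k : ℝ) ^ (8 * ρ + 4 * ρ') * (1 + Λ) ^ 2 *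
        ((dn : ℝ) ^ 2 * (4 * (k : ℝ) ^ (4 * ρ + 6 * ρ') * (k : ℝ) ^ ν + (k : ℝ) ^ (μ + 2 * ρ) * Λ)) := by
      positivity
    calc ∑ s ∈ Ico 1 (k ^ (2 * ρ)), ∑ r ∈ Ico 1 (k ^ ρ), X r s
        ≤ ∑ _s ∈ Ico 1 (k ^ (2 * ρ)), ∑ _r ∈ Ico 1 (k ^ ρ), (k : ℝ) ^ (8 * ρ + 4 * ρ') * (1 + Λ) ^ 2 *
            ((dn : ℝ) ^ 2 * (4 * (k : ℝ) ^ (4 * ρ + 6 * ρ') * (k : ℝ) ^ ν + (k : ℝ) ^ (μ + 2 * ρ) * Λ)) :=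
          sum_le_sum fun s _ => sum_le_sum fun r _ => hrs r s
      _ = ((k ^ (2 * ρ) - 1 : ℕ) : ℝ) * (((k ^ ρ - 1 : ℕ) : ℝ) * ((k : ℝ) ^ (8 * ρ + 4 * ρ') * (1 + Λ) ^ 2 *
            ((dn : ℝ) ^ 2 * (4 * (k : ℝ) ^ (4 * ρ + 6 * ρ') * (k : ℝ) ^ ν + (k : ℝ) ^ (μ + 2 * ρ) * Λ)))) := by
          rw [sum_const, Nat.card_Ico, nsmul_eq_mul, sum_const, Nat.card_Ico, nsmul_eq_mul]
      _ ≤ _ := by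
          have a : ((k ^ (2 * ρ) - 1 : ℕ) : ℝ) ≤ (k : ℝ) ^ (2 * ρ) := by
            have : ((k ^ (2 * ρ) - 1 : ℕ) : ℝ) ≤ ((k ^ (2 * ρ) : ℕ) : ℝ) := by exact_mod_cast Nat.sub_le _ _
            simpa using this
          have b : ((k ^ ρ - 1 : ℕ) : ℝ) ≤ (k : ℝ) ^ ρ := by
            have : ((k ^ ρ - 1 : ℕ) : ℝ) ≤ ((k ^ ρ : ℕ) : ℝ) := by exact_mod_cast Nat.sub_le _ _
            simpa using this
          gcongr
  refine hsum.trans ?_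
  have m1 : (k : ℝ) ^ (15 * ρ + 10 * ρ' + ν) ≤ (k : ℝ) ^ (3 * ρ + μ + ν) / (k : ℝ) ^ (2 * ρ') / (k : ℝ) ^ ρ :=
    kpow_le_div₂ hk1 (by omega)
  have m2 : (k : ℝ) ^ (11 * ρ + 4 * ρ' + (μ + 2 * ρ)) ≤ (k : ℝ) ^ (3 * ρ + μ + ν) / (k : ℝ) ^ (2 * ρ') / (k : ℝ) ^ ρ :=
    kpow_le_div₂ hk1 (by omega)
  have e : (k : ℝ) ^ (2 * ρ) * ((k : ℝ) ^ ρ * ((k : ℝ) ^ (8 * ρ + 4 * ρ') * (1 + Λ) ^ 2 *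
      ((dn : ℝ) ^ 2 * (4 * (k : ℝ) ^ (4 * ρ + 6 * ρ') * (k : ℝ) ^ ν + (k : ℝ) ^ (μ + 2 * ρ) * Λ)))) =
      (dn : ℝ) ^ 2 * (1 + Λ) ^ 2 * (4 * (k : ℝ) ^ (15 * ρ + 10 * ρ' + ν) + Λ * (k : ℝ) ^ (11 * ρ + 4 * ρ' + (μ + 2 * ρ))) := by
    ring
  rw [e]
  have a1 := mul_le_mul_of_nonneg_left m1 (by norm_num : (0:ℝ) ≤ 4)
  have a2 := mul_le_mul_of_nonneg_left m2 hΛ0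
  have hc : 0 ≤ (dn : ℝ) ^ 2 * (1 + Λ) ^ 2 := by positivity
  calc (dn : ℝ) ^ 2 * (1 + Λ) ^ 2 * (4 * (k : ℝ) ^ (15 * ρ + 10 * ρ' + ν) + Λ * (k : ℝ) ^ (11 * ρ + 4 * ρ' + (μ + 2 * ρ)))
      ≤ (dn : ℝ) ^ 2 * (1 + Λ) ^ 2 * ((k : ℝ) ^ (3 * ρ + μ + ν) / (k : ℝ) ^ (2 * ρ') / (k : ℝ) ^ ρ * (4 + Λ)) :=
        mul_le_mul_of_nonneg_left (by linarith) hc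
    _ = _ := by
        field_simp

/-! ## (73)–(84): the diagonal term with the parameters -/

/-- **`∑_{|a| ≤ k^{λ'} − 1} S₇(a) ≤ 2 · (the double sum of Lemma 10)`** (evenness of `S₇`).
[cite: MauduitRivat2015, (78)–(79)] -/
theorem sum_Icc_S7_le (U : G →* unitaryGroup d ℂ) (f : ℕ → G) (k μ₀ μ₁ μ₂ lam' : ℕ) (hk : 0 < k) :
    ∑ a ∈ Icc (-((k ^ lam' - 1 : ℕ) : ℤ)) ((k ^ lam' - 1 : ℕ) : ℤ), S7 U f k μ₀ μ₁ μ₂ a ≤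
      2 * ∑ h ∈ range (k ^ (μ₂ - μ₀)), ∑ j ∈ range (k ^ lam'),
        ‖(ghatR U f k μ₀ μ₁ μ₂ h)ᴴ * ghatR U f k μ₀ μ₁ μ₂ ((h + j : ℕ) : ℝ)‖ ^ 2 := by
  have hT : 1 ≤ k ^ lam' := Nat.one_le_pow _ _ hk
  have eI : Icc (-((k ^ lam' - 1 : ℕ) : ℤ)) ((k ^ lam' - 1 : ℕ) : ℤ) = Ioo (-((k ^ lam' : ℕ) : ℤ)) (k ^ lam' : ℕ) := by
    ext a
    simp only [mem_Icc, mem_Ioo]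
    push_cast [Nat.cast_sub hT]
    omega
  rw [eI, sum_Ioo_neg_eq (fun a => S7 U f k μ₀ μ₁ μ₂ a) hT]
  simp only [S7_neg]
  have hsw : ∑ h ∈ range (k ^ (μ₂ - μ₀)), ∑ j ∈ range (k ^ lam'),
      ‖(ghatR U f k μ₀ μ₁ μ₂ h)ᴴ * ghatR U f k μ₀ μ₁ μ₂ ((h + j : ℕ) : ℝ)‖ ^ 2 =
      ∑ j ∈ range (k ^ lam'), S7 U f k μ₀ μ₁ μ₂ (j : ℤ) := by
    rw [sum_comm]
    refine sum_congr rfl fun j _ => ?_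
    unfold S7
    refine sum_congr rfl fun h _ => ?_
    push_cast
    ring_nf
  rw [hsw, Finset.range_eq_Ico, Finset.sum_eq_sum_Ico_succ_bot (by omega : 0 < k ^ lam')]
  have h0 := S7_nonneg U f k μ₀ μ₁ μ₂ 0
  have := sum_nonneg fun (j : ℕ) (_ : j ∈ Ico (0 + 1) (k ^ lam')) => S7_nonneg U f k μ₀ μ₁ μ₂ (j : ℤ)
  simp only [zero_add, Nat.cast_zero, sum_add_distrib] at this ⊢
  linarith

/-- **Lemma 10 with the parameters**: for `ρ₃ = 4ρ' + a`, `μ₁ − μ₀ = 2ρ'`, `10ρ' + g ≤ γ(λ + ρ₃)`,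
twice the bound of Lemma 10 (`sum_sum_norm_sq_ghat_conj_mul_le`, `η = 1`) is at most
`2d (18 d Λ² k^{3a}/(k^{4ρ'} k^{2g}) + 8 d C/(k^{4ρ'} k^a))`. [cite: MauduitRivat2015, (80), (87)] -/
theorem rs_bound {k : ℕ} (hk : 2 ≤ k) {γ : ℝ → ℝ} {dn : ℕ} {C : ℝ}
    {μ μ₀ μ₁ lam ρ ρ' a g : ℕ} (hμ₀ : μ₀ + 2 * ρ' = μ₁)
    (hΛ' : lam + (4 * ρ' + a) - (μ₁ - μ₀) ≤ μ + 2 * ρ)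
    (hγ : ((10 * ρ' + g : ℕ) : ℝ) ≤ γ ((lam + (4 * ρ' + a) : ℕ) : ℝ)) {L : ℝ}
    (hL : L ≤ dn * (18 * dn * (k ^ (4 * ρ' + a) : ℕ) *
        ((k : ℝ) ^ (μ₁ - μ₀ + (4 * ρ' + a)) * (k : ℝ) ^ (-γ ((lam + (4 * ρ' + a) : ℕ) : ℝ)) *
          (1 + Real.log ((k : ℝ) ^ (lam + (4 * ρ' + a) - (μ₁ - μ₀))))) ^ 2 +
        8 * dn * C * (k : ℝ) ^ (-(1 * ((4 * ρ' + a : ℕ) : ℝ))))) :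
    2 * L ≤ 2 * dn * (18 * dn * (1 + Real.log ((k : ℝ) ^ (μ + 2 * ρ))) ^ 2 * (k : ℝ) ^ (3 * a) /
        ((k : ℝ) ^ (4 * ρ') * (k : ℝ) ^ (2 * g)) + 8 * dn * C / ((k : ℝ) ^ (4 * ρ') * (k : ℝ) ^ a)) := by
  have hk0' : 0 < k := by omega
  have hk1 : 1 ≤ k := by omega
  have hk0 : (0 : ℝ) < k := by exact_mod_cast hk0'
  have hk1R : (1 : ℝ) ≤ k := by exact_mod_cast hk1
  set Λ : ℝ := 1 + Real.log ((k : ℝ) ^ (μ + 2 * ρ)) with hΛ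
  have hΛ0 : 0 ≤ Λ := by have := log_pow_natCast_nonneg k (μ + 2 * ρ); rw [hΛ]; linarith
  have e1 : μ₁ - μ₀ + (4 * ρ' + a) = 6 * ρ' + a := by omega
  rw [e1] at hL
  set Γ : ℝ := (k : ℝ) ^ (-γ ((lam + (4 * ρ' + a) : ℕ) : ℝ)) with hΓ
  set ℓ : ℝ := 1 + Real.log ((k : ℝ) ^ (lam + (4 * ρ' + a) - (μ₁ - μ₀))) with hℓ
  have hΓ0 : 0 ≤ Γ := Real.rpow_nonneg hk0.le _
  have hℓ0 : 0 ≤ ℓ := by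
    have := log_pow_natCast_nonneg k (lam + (4 * ρ' + a) - (μ₁ - μ₀)); rw [hℓ]; linarith
  have hℓΛ : ℓ ≤ Λ := one_add_log_pow_le hk1 hΛ'
  have hΓle : Γ ≤ ((k : ℝ) ^ (10 * ρ' + g))⁻¹ := by
    have h := Real.rpow_le_rpow_of_exponent_le hk1R (neg_le_neg hγ)
    have e : (k : ℝ) ^ (-(((10 * ρ' + g : ℕ)) : ℝ)) = ((k : ℝ) ^ (10 * ρ' + g))⁻¹ := by
      rw [Real.rpow_neg hk0.le, Real.rpow_natCast]
    exact h.trans e.le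
  have hlast : (k : ℝ) ^ (-(1 * ((4 * ρ' + a : ℕ) : ℝ))) = ((k : ℝ) ^ (4 * ρ') * (k : ℝ) ^ a)⁻¹ := by
    rw [one_mul, Real.rpow_neg hk0.le, Real.rpow_natCast, pow_add]
  -- the square
  have hCb : (k : ℝ) ^ (6 * ρ' + a) * Γ * ℓ ≤ (k : ℝ) ^ (6 * ρ' + a) * ((k : ℝ) ^ (10 * ρ' + g))⁻¹ * Λ :=
    mul_le_mul (mul_le_mul_of_nonneg_left hΓle (by positivity)) hℓΛ hℓ0 (by positivity)
  have hCb0 : 0 ≤ (k : ℝ) ^ (6 * ρ' + a) * Γ * ℓ := by positivity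
  have hsq : ((k : ℝ) ^ (6 * ρ' + a) * Γ * ℓ) ^ 2 ≤ ((k : ℝ) ^ (6 * ρ' + a) * ((k : ℝ) ^ (10 * ρ' + g))⁻¹ * Λ) ^ 2 :=
    pow_le_pow_left₀ hCb0 hCb 2
  have key : ((k ^ (4 * ρ' + a) : ℕ) : ℝ) * ((k : ℝ) ^ (6 * ρ' + a) * ((k : ℝ) ^ (10 * ρ' + g))⁻¹ * Λ) ^ 2 =
      Λ ^ 2 * (k : ℝ) ^ (3 * a) / ((k : ℝ) ^ (4 * ρ') * (k : ℝ) ^ (2 * g)) := by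
    push_cast
    field_simp
    ring
  have h1 : ((k ^ (4 * ρ' + a) : ℕ) : ℝ) * ((k : ℝ) ^ (6 * ρ' + a) * Γ * ℓ) ^ 2 ≤
      Λ ^ 2 * (k : ℝ) ^ (3 * a) / ((k : ℝ) ^ (4 * ρ') * (k : ℝ) ^ (2 * g)) := by
    rw [← key]; exact mul_le_mul_of_nonneg_left hsq (by positivity)
  rw [hlast] at hL
  have h2 : (dn : ℝ) * (18 * dn * (k ^ (4 * ρ' + a) : ℕ) * ((k : ℝ) ^ (6 * ρ' + a) * Γ * ℓ) ^ 2 +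
      8 * dn * C * ((k : ℝ) ^ (4 * ρ') * (k : ℝ) ^ a)⁻¹) ≤
      dn * (18 * dn * (Λ ^ 2 * (k : ℝ) ^ (3 * a) / ((k : ℝ) ^ (4 * ρ') * (k : ℝ) ^ (2 * g))) +
        8 * dn * C * ((k : ℝ) ^ (4 * ρ') * (k : ℝ) ^ a)⁻¹) := by
    have : (18 : ℝ) * dn * (k ^ (4 * ρ' + a) : ℕ) * ((k : ℝ) ^ (6 * ρ' + a) * Γ * ℓ) ^ 2 =
        18 * dn * (((k ^ (4 * ρ' + a) : ℕ) : ℝ) * ((k : ℝ) ^ (6 * ρ' + a) * Γ * ℓ) ^ 2) := by ring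
    rw [this]
    have := mul_le_mul_of_nonneg_left h1 (by positivity : (0 : ℝ) ≤ 18 * dn)
    have hdn : (0 : ℝ) ≤ dn := Nat.cast_nonneg _
    nlinarith
  refine (mul_le_mul_of_nonneg_left (hL.trans h2) (by norm_num : (0 : ℝ) ≤ 2)).trans (le_of_eq ?_)
  field_simp

set_option maxHeartbeats 800000 in
/-- **The term `∑_r∑_s |S₄'(r,s)|` of the chain** bounded by `sum_sum_norm_corrS4rDiag_le` with
`μ₂ = μ + 2ρ`, `μ₁ = μ − 2ρ`, `μ₀ = μ₁ − 2ρ'`, `R = k^ρ`, `S = k^{2ρ}`, `T = k^{λ'} − 1`,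
`λ' = ρ + 4ρ' + b`, `λ + 2ρ' + b = 3ρ`, and `RS` bounded by `rs_bound`:
`≤ k^{3ρ+μ+ν}/k^{2ρ'} · (72 d² D Λ² k^{3a}/k^{2g} + 32 d² C D/k^a + 4 d² D Λ/k^b + (…)/k^ρ)`.
[cite: MauduitRivat2015, (81)–(84), (87)–(88)] -/
theorem diag_term_le {k : ℕ} (hk : 2 ≤ k) {μ ν ρ ρ' a b g μ₀ μ₁ lam : ℕ} (hμ₁ : μ₁ + 2 * ρ = μ)
    (hμ₀ : μ₀ + 2 * ρ' = μ₁) (hlam : lam + 2 * ρ' + b = 3 * ρ) (hρ' : ρ' ≤ ρ) (hν5 : 5 * ρ ≤ ν)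
    (hν2 : 2 * ρ + 2 * ρ' ≤ ν) (hρ : 1 ≤ ρ) {dn : ℕ} {C RS X : ℝ} (hC : 0 ≤ C) (hRS0 : 0 ≤ RS)
    (hRS : RS ≤ 2 * dn * (18 * dn * (1 + Real.log ((k : ℝ) ^ (μ + 2 * ρ))) ^ 2 * (k : ℝ) ^ (3 * a) /
        ((k : ℝ) ^ (4 * ρ') * (k : ℝ) ^ (2 * g)) + 8 * dn * C / ((k : ℝ) ^ (4 * ρ') * (k : ℝ) ^ a)))
    {Mlen Nlen : ℕ} (hMlen : Mlen ≤ k ^ μ) (hNle : Nlen ≤ k ^ ν)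
    (hX : X ≤ ((k ^ (μ₁ - μ₀) : ℕ) : ℝ) *
        (2 * ((k ^ (2 * ρ) - 1 : ℕ) : ℝ) * ((k ^ (μ + 2 * ρ - μ₁)).divisors.card : ℝ) * (Nlen : ℝ) +
          ((k ^ (2 * ρ) - 1 : ℕ) : ℝ) * ((k ^ (μ + 2 * ρ - μ₁) : ℕ) *
            (1 + Real.log ((k ^ (μ + 2 * ρ - μ₁) : ℕ) : ℝ)))) *
        (((k ^ ρ : ℕ) : ℝ) * (Mlen : ℝ) * RS +
          (((k ^ (μ + 2 * ρ) : ℕ) : ℝ) / ((k ^ (ρ + 4 * ρ' + b) - 1 : ℕ) : ℝ) + (k ^ μ₀ : ℕ)) *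
            (dn : ℝ) ^ 2 * (1 + Real.log ((k ^ ρ : ℕ) : ℝ)))) :
    X ≤ (k : ℝ) ^ (3 * ρ + μ + ν) / (k : ℝ) ^ (2 * ρ') *
      (72 * (dn : ℝ) ^ 2 * ((k ^ (μ + 2 * ρ)).divisors.card : ℝ) *
          (1 + Real.log ((k : ℝ) ^ (μ + 2 * ρ))) ^ 2 * (k : ℝ) ^ (3 * a) / (k : ℝ) ^ (2 * g) +
        32 * (dn : ℝ) ^ 2 * C * ((k ^ (μ + 2 * ρ)).divisors.card : ℝ) / (k : ℝ) ^ a +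
        4 * ((k ^ (μ + 2 * ρ)).divisors.card : ℝ) * (dn : ℝ) ^ 2 *
          (1 + Real.log ((k : ℝ) ^ (μ + 2 * ρ))) / (k : ℝ) ^ b +
        (2 * dn * (1 + Real.log ((k : ℝ) ^ (μ + 2 * ρ))) *
            (18 * dn * (1 + Real.log ((k : ℝ) ^ (μ + 2 * ρ))) ^ 2 * (k : ℝ) ^ (3 * a) + 8 * dn * C) +
          2 * ((k ^ (μ + 2 * ρ)).divisors.card : ℝ) * (dn : ℝ) ^ 2 * (1 + Real.log ((k : ℝ) ^ (μ + 2 * ρ))) +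
          3 * (dn : ℝ) ^ 2 * (1 + Real.log ((k : ℝ) ^ (μ + 2 * ρ))) ^ 2) / (k : ℝ) ^ ρ) := by
  have hk0' : 0 < k := by omega
  have hk1 : 1 ≤ k := by omega
  have hk0 : (0 : ℝ) < k := by exact_mod_cast hk0'
  have hk2 : (2 : ℝ) ≤ k := by exact_mod_cast hk
  set D : ℝ := ((k ^ (μ + 2 * ρ)).divisors.card : ℝ) with hD
  set Λ : ℝ := 1 + Real.log ((k : ℝ) ^ (μ + 2 * ρ)) with hΛ
  have hD0 : 0 ≤ D := Nat.cast_nonneg _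
  have hΛ1 : 1 ≤ Λ := by have := log_pow_natCast_nonneg k (μ + 2 * ρ); rw [hΛ]; linarith
  have hΛ0 : 0 ≤ Λ := by linarith
  set RSB : ℝ := 2 * dn * (18 * dn * Λ ^ 2 * (k : ℝ) ^ (3 * a) / ((k : ℝ) ^ (4 * ρ') * (k : ℝ) ^ (2 * g)) +
    8 * dn * C / ((k : ℝ) ^ (4 * ρ') * (k : ℝ) ^ a)) with hRSB
  have hRSB0 : 0 ≤ RSB := by positivity
  have e1 : μ₁ - μ₀ = 2 * ρ' := by omega
  have e2 : μ + 2 * ρ - μ₁ = 4 * ρ := by omega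
  rw [e1, e2] at hX
  simp only [Nat.cast_pow] at hX
  -- atoms and their bounds
  set S₀ : ℝ := ((k ^ (2 * ρ) - 1 : ℕ) : ℝ) with hS₀
  set T₀ : ℝ := ((k ^ (ρ + 4 * ρ' + b) - 1 : ℕ) : ℝ) with hT₀
  set τ₄ : ℝ := ((k ^ (4 * ρ)).divisors.card : ℝ) with hτ₄
  set ℓ₄ : ℝ := 1 + Real.log ((k : ℝ) ^ (4 * ρ)) with hℓ₄
  set ℓ₁ : ℝ := 1 + Real.log ((k : ℝ) ^ ρ) with hℓ₁
  have hS₀0 : 0 ≤ S₀ := Nat.cast_nonneg _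
  have hS₀le : S₀ ≤ (k : ℝ) ^ (2 * ρ) := by
    have : S₀ ≤ ((k ^ (2 * ρ) : ℕ) : ℝ) := by rw [hS₀]; exact_mod_cast Nat.sub_le _ _
    simpa using this
  have hτ₄0 : 0 ≤ τ₄ := Nat.cast_nonneg _
  have hτ₄le : τ₄ ≤ D := card_divisors_pow_le hk0' (by omega)
  have hℓ₄0 : 0 ≤ ℓ₄ := by have := log_pow_natCast_nonneg k (4 * ρ); rw [hℓ₄]; linarith
  have hℓ₄le : ℓ₄ ≤ Λ := one_add_log_pow_le hk1 (by omega)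
  have hℓ₁0 : 0 ≤ ℓ₁ := by have := log_pow_natCast_nonneg k ρ; rw [hℓ₁]; linarith
  have hℓ₁le : ℓ₁ ≤ Λ := one_add_log_pow_le hk1 (by omega)
  have hNR : (Nlen : ℝ) ≤ (k : ℝ) ^ ν := by exact_mod_cast hNle
  have hMR : (Mlen : ℝ) ≤ (k : ℝ) ^ μ := by exact_mod_cast hMlen
  -- `K / T ≤ 2 k^{μ₀+λ}`
  have eK : (k : ℝ) ^ (μ₀ + lam) * (k : ℝ) ^ (ρ + 4 * ρ' + b) = (k : ℝ) ^ (μ + 2 * ρ) := by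
    rw [← pow_add]; congr 1; omega
  have hT' : (2 : ℝ) ≤ (k : ℝ) ^ (ρ + 4 * ρ' + b) := by
    calc (2 : ℝ) ≤ k := hk2
      _ = (k : ℝ) ^ 1 := (pow_one _).symm
      _ ≤ _ := pow_le_pow_right₀ (by linarith) (by omega)
  have hT₀e : T₀ = (k : ℝ) ^ (ρ + 4 * ρ' + b) - 1 := by
    rw [hT₀]; push_cast [Nat.cast_sub (Nat.one_le_pow _ _ hk0')]; ring
  have hT₀pos : 0 < T₀ := by rw [hT₀e]; linarith
  have hfrac : (k : ℝ) ^ (μ + 2 * ρ) / T₀ ≤ 2 * (k : ℝ) ^ (μ₀ + lam) := by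
    rw [div_le_iff₀ hT₀pos, hT₀e, ← eK]
    have h0 : (0 : ℝ) ≤ (k : ℝ) ^ (μ₀ + lam) := by positivity
    nlinarith [mul_le_mul_of_nonneg_left hT' h0]
  -- the two brackets
  set B : ℝ := 2 * S₀ * τ₄ * (Nlen : ℝ) + S₀ * ((k : ℝ) ^ (4 * ρ) * ℓ₄) with hB
  set B' : ℝ := 2 * (k : ℝ) ^ (2 * ρ) * D * (k : ℝ) ^ ν + (k : ℝ) ^ (2 * ρ) * ((k : ℝ) ^ (4 * ρ) * Λ) with hB'
  set Cc : ℝ := (k : ℝ) ^ ρ * (Mlen : ℝ) * RS + ((k : ℝ) ^ (μ + 2 * ρ) / T₀ + (k : ℝ) ^ μ₀) * (dn : ℝ) ^ 2 * ℓ₁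
    with hCc
  set Cc' : ℝ := (k : ℝ) ^ ρ * (k : ℝ) ^ μ * RSB + (2 * (k : ℝ) ^ (μ₀ + lam) + (k : ℝ) ^ μ₀) * (dn : ℝ) ^ 2 * Λ
    with hCc'
  have hBle : B ≤ B' := by
    rw [hB, hB']
    refine add_le_add ?_ ?_
    · exact mul_le_mul (mul_le_mul (mul_le_mul_of_nonneg_left hS₀le (by norm_num)) hτ₄le hτ₄0
        (by positivity)) hNR (Nat.cast_nonneg _) (by positivity)
    · exact mul_le_mul hS₀le (mul_le_mul_of_nonneg_left hℓ₄le (by positivity))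
        (mul_nonneg (by positivity) hℓ₄0) (by positivity)
  have hC0 : 0 ≤ Cc := by
    rw [hCc]
    have : 0 ≤ (k : ℝ) ^ (μ + 2 * ρ) / T₀ := by positivity
    positivity
  have hCle : Cc ≤ Cc' := by
    rw [hCc, hCc']
    refine add_le_add ?_ ?_
    · exact mul_le_mul (mul_le_mul_of_nonneg_left hMR (by positivity)) hRS hRS0 (by positivity)
    · refine mul_le_mul (mul_le_mul_of_nonneg_right (add_le_add hfrac le_rfl) (by positivity)) hℓ₁le hℓ₁0
        (by positivity)
  have hX' : X ≤ (k : ℝ) ^ (2 * ρ') * B' * Cc' := by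
    refine hX.trans ?_
    exact mul_le_mul (mul_le_mul_of_nonneg_left hBle (by positivity)) hCle hC0 (by positivity)
  refine hX'.trans ?_
  -- expand into six pieces
  have esplit : (k : ℝ) ^ (2 * ρ') * B' * Cc' =
      2 * D * (k : ℝ) ^ (2 * ρ') * (k : ℝ) ^ (3 * ρ + μ + ν) * RSB +
      Λ * (k : ℝ) ^ (2 * ρ' + 7 * ρ + μ) * RSB +
      4 * D * (dn : ℝ) ^ 2 * Λ * (k : ℝ) ^ (2 * ρ' + 2 * ρ + ν + μ₀ + lam) +
      2 * D * (dn : ℝ) ^ 2 * Λ * (k : ℝ) ^ (2 * ρ' + 2 * ρ + ν + μ₀) +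
      2 * (dn : ℝ) ^ 2 * Λ ^ 2 * (k : ℝ) ^ (2 * ρ' + 6 * ρ + μ₀ + lam) +
      (dn : ℝ) ^ 2 * Λ ^ 2 * (k : ℝ) ^ (2 * ρ' + 6 * ρ + μ₀) := by
    rw [hB', hCc']; ring
  rw [esplit]
  -- piece 1 (exact)
  have e4 : (k : ℝ) ^ (4 * ρ') = (k : ℝ) ^ (2 * ρ') * (k : ℝ) ^ (2 * ρ') := by rw [← pow_add]; congr 1; omega
  have p1 : 2 * D * (k : ℝ) ^ (2 * ρ') * (k : ℝ) ^ (3 * ρ + μ + ν) * RSB =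
      (k : ℝ) ^ (3 * ρ + μ + ν) / (k : ℝ) ^ (2 * ρ') *
        (72 * (dn : ℝ) ^ 2 * D * Λ ^ 2 * (k : ℝ) ^ (3 * a) / (k : ℝ) ^ (2 * g) +
          32 * (dn : ℝ) ^ 2 * C * D / (k : ℝ) ^ a) := by
    rw [hRSB, e4]
    field_simp
    ring
  -- piece 2
  have hRSB' : RSB ≤ 2 * dn * (18 * dn * Λ ^ 2 * (k : ℝ) ^ (3 * a) + 8 * dn * C) / (k : ℝ) ^ (4 * ρ') := by
    rw [hRSB]
    have hk4 : (0 : ℝ) < (k : ℝ) ^ (4 * ρ') := by positivity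
    have i1 : 18 * dn * Λ ^ 2 * (k : ℝ) ^ (3 * a) / ((k : ℝ) ^ (4 * ρ') * (k : ℝ) ^ (2 * g)) ≤
        18 * dn * Λ ^ 2 * (k : ℝ) ^ (3 * a) / (k : ℝ) ^ (4 * ρ') :=
      div_le_div_of_nonneg_left (by positivity) hk4
        (le_mul_of_one_le_right hk4.le (one_le_pow₀ (by exact_mod_cast hk1)))
    have i2 : 8 * dn * C / ((k : ℝ) ^ (4 * ρ') * (k : ℝ) ^ a) ≤ 8 * dn * C / (k : ℝ) ^ (4 * ρ') :=
      div_le_div_of_nonneg_left (by positivity) hk4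
        (le_mul_of_one_le_right hk4.le (one_le_pow₀ (by exact_mod_cast hk1)))
    have hdn : (0 : ℝ) ≤ dn := Nat.cast_nonneg _
    calc 2 * (dn : ℝ) * (18 * dn * Λ ^ 2 * (k : ℝ) ^ (3 * a) / ((k : ℝ) ^ (4 * ρ') * (k : ℝ) ^ (2 * g)) +
          8 * dn * C / ((k : ℝ) ^ (4 * ρ') * (k : ℝ) ^ a))
        ≤ 2 * dn * (18 * dn * Λ ^ 2 * (k : ℝ) ^ (3 * a) / (k : ℝ) ^ (4 * ρ') + 8 * dn * C / (k : ℝ) ^ (4 * ρ')) :=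
          mul_le_mul_of_nonneg_left (add_le_add i1 i2) (by positivity)
      _ = _ := by rw [← add_div, ← mul_div_assoc]
  have m2 : (k : ℝ) ^ (2 * ρ' + 7 * ρ + μ) / (k : ℝ) ^ (4 * ρ') ≤
      (k : ℝ) ^ (3 * ρ + μ + ν) / (k : ℝ) ^ (2 * ρ') / (k : ℝ) ^ ρ := by
    have h := kpow_le_div hk1 (A := 7 * ρ + μ) (B := 3 * ρ + μ + ν) (e := ρ) (by omega)
    have e : (k : ℝ) ^ (2 * ρ' + 7 * ρ + μ) / (k : ℝ) ^ (4 * ρ') = (k : ℝ) ^ (7 * ρ + μ) / (k : ℝ) ^ (2 * ρ') := by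
      rw [e4, pow_add, pow_add, pow_add]
      field_simp
    rw [e, div_right_comm]
    exact div_le_div_of_nonneg_right h (by positivity)
  have p2 : Λ * (k : ℝ) ^ (2 * ρ' + 7 * ρ + μ) * RSB ≤
      (k : ℝ) ^ (3 * ρ + μ + ν) / (k : ℝ) ^ (2 * ρ') / (k : ℝ) ^ ρ *
        (2 * dn * Λ * (18 * dn * Λ ^ 2 * (k : ℝ) ^ (3 * a) + 8 * dn * C)) := by
    calc Λ * (k : ℝ) ^ (2 * ρ' + 7 * ρ + μ) * RSB
        ≤ Λ * (k : ℝ) ^ (2 * ρ' + 7 * ρ + μ) *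
            (2 * dn * (18 * dn * Λ ^ 2 * (k : ℝ) ^ (3 * a) + 8 * dn * C) / (k : ℝ) ^ (4 * ρ')) :=
          mul_le_mul_of_nonneg_left hRSB' (by positivity)
      _ = ((k : ℝ) ^ (2 * ρ' + 7 * ρ + μ) / (k : ℝ) ^ (4 * ρ')) *
            (2 * dn * Λ * (18 * dn * Λ ^ 2 * (k : ℝ) ^ (3 * a) + 8 * dn * C)) := by
          field_simp
      _ ≤ _ := mul_le_mul_of_nonneg_right m2 (by positivity)
  -- piece 3 (exact)
  have p3 : (k : ℝ) ^ (2 * ρ' + 2 * ρ + ν + μ₀ + lam) =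
      (k : ℝ) ^ (3 * ρ + μ + ν) / (k : ℝ) ^ (2 * ρ') / (k : ℝ) ^ b := by
    rw [eq_div_iff (by positivity), eq_div_iff (by positivity), ← pow_add, ← pow_add]
    congr 1; omega
  -- pieces 4, 5, 6
  have p4 : (k : ℝ) ^ (2 * ρ' + 2 * ρ + ν + μ₀) ≤ (k : ℝ) ^ (3 * ρ + μ + ν) / (k : ℝ) ^ (2 * ρ') / (k : ℝ) ^ ρ :=
    kpow_le_div₂ hk1 (by omega)
  have p5 : (k : ℝ) ^ (2 * ρ' + 6 * ρ + μ₀ + lam) ≤ (k : ℝ) ^ (3 * ρ + μ + ν) / (k : ℝ) ^ (2 * ρ') / (k : ℝ) ^ ρ :=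
    kpow_le_div₂ hk1 (by omega)
  have p6 : (k : ℝ) ^ (2 * ρ' + 6 * ρ + μ₀) ≤ (k : ℝ) ^ (3 * ρ + μ + ν) / (k : ℝ) ^ (2 * ρ') / (k : ℝ) ^ ρ :=
    kpow_le_div₂ hk1 (by omega)
  have a4 := mul_le_mul_of_nonneg_left p4 (by positivity : 0 ≤ 2 * D * (dn : ℝ) ^ 2 * Λ)
  have a5 := mul_le_mul_of_nonneg_left p5 (by positivity : 0 ≤ 2 * (dn : ℝ) ^ 2 * Λ ^ 2)
  have a6 := mul_le_mul_of_nonneg_left p6 (by positivity : 0 ≤ (dn : ℝ) ^ 2 * Λ ^ 2)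
  rw [p1, p3]
  have hfin : (k : ℝ) ^ (3 * ρ + μ + ν) / (k : ℝ) ^ (2 * ρ') *
        (72 * (dn : ℝ) ^ 2 * D * Λ ^ 2 * (k : ℝ) ^ (3 * a) / (k : ℝ) ^ (2 * g) +
          32 * (dn : ℝ) ^ 2 * C * D / (k : ℝ) ^ a) +
      (k : ℝ) ^ (3 * ρ + μ + ν) / (k : ℝ) ^ (2 * ρ') / (k : ℝ) ^ ρ *
        (2 * dn * Λ * (18 * dn * Λ ^ 2 * (k : ℝ) ^ (3 * a) + 8 * dn * C)) +
      4 * D * (dn : ℝ) ^ 2 * Λ * ((k : ℝ) ^ (3 * ρ + μ + ν) / (k : ℝ) ^ (2 * ρ') / (k : ℝ) ^ b) +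
      2 * D * (dn : ℝ) ^ 2 * Λ * ((k : ℝ) ^ (3 * ρ + μ + ν) / (k : ℝ) ^ (2 * ρ') / (k : ℝ) ^ ρ) +
      2 * (dn : ℝ) ^ 2 * Λ ^ 2 * ((k : ℝ) ^ (3 * ρ + μ + ν) / (k : ℝ) ^ (2 * ρ') / (k : ℝ) ^ ρ) +
      (dn : ℝ) ^ 2 * Λ ^ 2 * ((k : ℝ) ^ (3 * ρ + μ + ν) / (k : ℝ) ^ (2 * ρ') / (k : ℝ) ^ ρ) =
      (k : ℝ) ^ (3 * ρ + μ + ν) / (k : ℝ) ^ (2 * ρ') *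
      (72 * (dn : ℝ) ^ 2 * D * Λ ^ 2 * (k : ℝ) ^ (3 * a) / (k : ℝ) ^ (2 * g) +
        32 * (dn : ℝ) ^ 2 * C * D / (k : ℝ) ^ a + 4 * D * (dn : ℝ) ^ 2 * Λ / (k : ℝ) ^ b +
        (2 * dn * Λ * (18 * dn * Λ ^ 2 * (k : ℝ) ^ (3 * a) + 8 * dn * C) + 2 * D * (dn : ℝ) ^ 2 * Λ +
          3 * (dn : ℝ) ^ 2 * Λ ^ 2) / (k : ℝ) ^ ρ) := by
    field_simp
    ring
  linarith [hfin, p2, a4, a5, a6]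

/-! ## The type-II estimate with the parameters -/

/-- Bookkeeping: `XS ≤ S(A + B) + DG + OF` and bounds for the four pieces. [folklore] -/
theorem chain4_le {XS S A B DG OF b₁ b₂ b₃ b₄ : ℝ} (h : XS ≤ S * (A + B) + DG + OF)
    (h₁ : S * A ≤ b₁) (h₂ : S * B ≤ b₂) (h₃ : DG ≤ b₃) (h₄ : OF ≤ b₄) :
    XS ≤ b₁ + b₂ + b₃ + b₄ := by
  have := mul_add S A B
  linarith

set_option maxHeartbeats 1600000 in
/-- **Mauduit–Rivat's type-II estimate for unitary matrices, with the parameters (86)–(90).**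
Let `k ≥ 2`, `f` with the carry property (`η = 1`, constant `C`), `F = U ∘ f` with the Fourier
property `(γ, c)`, `‖B_n‖ ≤ 1`, and natural parameters with `1 ≤ ρ`, `ρ' ≤ ρ`,
`13ρ + 12ρ' ≤ μ`, `11ρ + 6ρ' ≤ ν`, `a + 1 ≤ ρ + b`, `μ₁ = μ − 2ρ`, `μ₀ = μ₁ − 2ρ'`,
`λ + 2ρ' + b = 3ρ`, `2ρ' ≤ λ`, `μ₀ ≤ c (λ + 4ρ' + a)` and `10ρ' + g ≤ γ(λ + 4ρ' + a)`. Then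
`∑_{k^{μ-1} ≤ m < k^μ} ‖∑_{k^{ν-1} ≤ n < k^ν} e(ϑmn) B_n F(mn)‖²
  ≤ k^μ k^{2ν} ((2 + 24√d kC + 4√(2d))/k^ρ + 8 √Ψ / k^{ρ'})`
with `Ψ = 16dC + 20d + P/k^ρ + 72d²DΛ²k^{3a}/k^{2g} + 32d²CD/k^a + 4d²DΛ/k^b`
(`D = τ(k^{μ+2ρ})`, `Λ = 1 + log k^{μ+2ρ}`, `P` the displayed polynomial): this is (90),
`|S_II|⁴ ≪ M⁴N⁴ (k^{−2ρ'} + …)`, with all constants and lower-order terms explicit and without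
the hypothesis `M ≤ N`. [cite: MauduitRivat2015, Prop. 2, §6.5 (86)–(90)]
[cite: Mullner2017, Prop. 5.5] -/
theorem typeIISq_le_params (U : G →* unitaryGroup d ℂ) {f : ℕ → G} {k : ℕ} (hk : 2 ≤ k)
    {C : ℝ} (hcarry : HasCarryProperty k 1 C f) {γ : ℝ → ℝ} {c : ℝ}
    (hfour : HasFourierProperty k γ c (umat U f)) (ϑ : ℝ) {B : ℕ → Matrix d d ℂ}
    (hB : ∀ n, ‖B n‖ ≤ 1) {μ ν ρ ρ' a b g μ₀ μ₁ lam : ℕ} (hρ : 1 ≤ ρ) (hρ' : ρ' ≤ ρ)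
    (hμ : 13 * ρ + 12 * ρ' ≤ μ) (hν : 11 * ρ + 6 * ρ' ≤ ν) (hab : a + 1 ≤ ρ + b)
    (hμ₁ : μ₁ + 2 * ρ = μ) (hμ₀ : μ₀ + 2 * ρ' = μ₁) (hlam : lam + 2 * ρ' + b = 3 * ρ)
    (hlam2 : 2 * ρ' ≤ lam) (hc : (μ₀ : ℝ) ≤ c * ((lam + (4 * ρ' + a) : ℕ) : ℝ))
    (hγ : ((10 * ρ' + g : ℕ) : ℝ) ≤ γ ((lam + (4 * ρ' + a) : ℕ) : ℝ)) :
    typeIISq ϑ B (umat U f) (k ^ (μ - 1)) (k ^ μ) (k ^ (ν - 1)) (k ^ ν) ≤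
      (k : ℝ) ^ μ * ((k : ℝ) ^ ν) ^ 2 *
        ((2 + 24 * Real.sqrt (Fintype.card d : ℝ) * (k * C) + 4 * Real.sqrt (2 * (Fintype.card d : ℝ))) /
            (k : ℝ) ^ ρ +
          8 * Real.sqrt (16 * (Fintype.card d : ℝ) * C + 20 * (Fintype.card d : ℝ) +
            ((32 * (Fintype.card d : ℝ) * C * (1 + Real.log ((k : ℝ) ^ (μ + 2 * ρ))) *
                  (2 * ((k ^ (μ + 2 * ρ)).divisors.card : ℝ) + 2 + (1 + Real.log ((k : ℝ) ^ (μ + 2 * ρ)))) +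
                64 * (Fintype.card d : ℝ) * (1 + ((k ^ (μ + 2 * ρ)).divisors.card : ℝ))) +
              (64 * (Fintype.card d : ℝ) * (1 + Real.log ((k : ℝ) ^ (μ + 2 * ρ))) *
                  (2 * ((k ^ (μ + 2 * ρ)).divisors.card : ℝ) + 2 + (1 + Real.log ((k : ℝ) ^ (μ + 2 * ρ)))) +
                32 * (Fintype.card d : ℝ) * (1 + ((k ^ (μ + 2 * ρ)).divisors.card : ℝ))) +
              (2 * (Fintype.card d : ℝ) * (1 + Real.log ((k : ℝ) ^ (μ + 2 * ρ))) *
                  (18 * (Fintype.card d : ℝ) * (1 + Real.log ((k : ℝ) ^ (μ + 2 * ρ))) ^ 2 * (k : ℝ) ^ (3 * a) +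
                    8 * (Fintype.card d : ℝ) * C) +
                2 * ((k ^ (μ + 2 * ρ)).divisors.card : ℝ) * (Fintype.card d : ℝ) ^ 2 * (1 + Real.log ((k : ℝ) ^ (μ + 2 * ρ))) +
                3 * (Fintype.card d : ℝ) ^ 2 * (1 + Real.log ((k : ℝ) ^ (μ + 2 * ρ))) ^ 2) +
              (Fintype.card d : ℝ) ^ 2 * (1 + (1 + Real.log ((k : ℝ) ^ (μ + 2 * ρ)))) ^ 2 *
                (4 + (1 + Real.log ((k : ℝ) ^ (μ + 2 * ρ))))) / (k : ℝ) ^ ρ +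
            72 * (Fintype.card d : ℝ) ^ 2 * ((k ^ (μ + 2 * ρ)).divisors.card : ℝ) * (1 + Real.log ((k : ℝ) ^ (μ + 2 * ρ))) ^ 2 *
              (k : ℝ) ^ (3 * a) / (k : ℝ) ^ (2 * g) +
            32 * (Fintype.card d : ℝ) ^ 2 * C * ((k ^ (μ + 2 * ρ)).divisors.card : ℝ) / (k : ℝ) ^ a +
            4 * ((k ^ (μ + 2 * ρ)).divisors.card : ℝ) * (Fintype.card d : ℝ) ^ 2 * (1 + Real.log ((k : ℝ) ^ (μ + 2 * ρ))) / (k : ℝ) ^ b) / (k : ℝ) ^ ρ') := by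
  have hk0 : 0 < k := by omega
  have hk1 : 1 ≤ k := by omega
  have hkR : (0 : ℝ) < k := by exact_mod_cast hk0
  have hk1R : (1 : ℝ) ≤ k := by exact_mod_cast hk1
  have hkne : (k : ℝ) ≠ 0 := hkR.ne'
  have hd0 : 0 ≤ (Fintype.card d : ℝ) := Nat.cast_nonneg _
  -- exponent bookkeeping
  have h01 : μ₀ ≤ μ₁ := by omega
  have h12 : μ₁ ≤ μ + 2 * ρ := by omega
  have h12' : μ₁ < μ + 2 * ρ := by omega
  have h02 : μ₀ ≤ μ + 2 * ρ := by omega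
  have hμ₀' : μ₀ + 2 * ρ + 2 * ρ' = μ := by omega
  obtain ⟨w, hw⟩ : ∃ w, w + 2 * ρ' = μ₀ := ⟨μ₀ - 2 * ρ', by omega⟩
  -- the exceptional set of the middle digits and `C ≥ 0`
  have hnB : ((midViolations k μ₀ μ₁ (μ + 2 * ρ) f).card : ℝ) ≤ C * (k : ℝ) ^ (4 * ρ) := by
    have h := card_midViolations_le hcarry h01 h12'
    have e1 : μ + 2 * ρ - μ₀ = 4 * ρ + 2 * ρ' := by omega
    have e2 : μ₁ - μ₀ = 2 * ρ' := by omega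
    rw [e1, e2] at h
    have e3 : (((4 * ρ + 2 * ρ' : ℕ) : ℝ) - 1 * ((2 * ρ' : ℕ) : ℝ)) = ((4 * ρ : ℕ) : ℝ) := by
      push_cast; ring
    rw [e3, Real.rpow_natCast] at h
    exact h
  have hC0 : 0 ≤ C := by
    by_contra h
    push Not at h
    have : C * (k : ℝ) ^ (4 * ρ) < 0 := mul_neg_of_neg_of_pos h (by positivity)
    linarith [Nat.cast_nonneg (α := ℝ) (midViolations k μ₀ μ₁ (μ + 2 * ρ) f).card]
  -- Step 1: opening (51)–(54)
  have hT := typeIISq_le_open U f hk ϑ hB μ ν ρ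
  -- Step 2: van der Corput for `Y` (55)–(56)
  have hS1 : 1 ≤ k ^ (2 * ρ) := Nat.one_le_pow _ _ hk0
  have hL1 : 1 ≤ k ^ μ₁ := Nat.one_le_pow _ _ hk0
  have hMle : k ^ (μ - 1) ≤ k ^ μ := Nat.pow_le_pow_right hk0 (by omega)
  have hNle : k ^ (ν - 1) ≤ k ^ ν := Nat.pow_le_pow_right hk0 (by omega)
  have hY := sum_innerY_le_vdC U (trunc k (μ + 2 * ρ) f) ϑ hMle (k ^ (ν - 1)) (k ^ ν) (k ^ ρ)
    (k ^ μ₁) hS1 hL1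
  have eLS : ((k ^ μ₁ : ℕ) : ℝ) * ((k ^ (2 * ρ) : ℕ) : ℝ) = (k : ℝ) ^ μ := by
    push_cast; rw [← pow_add, hμ₁]
  rw [eLS] at hY
  -- Step 3: the chain (57)–(72) with the sharp counts
  have hM₀1 : 1 ≤ k ^ (μ - 1) := Nat.one_le_pow _ _ hk0
  have hwle : w ≤ μ₀ := by omega
  have hH0 : 0 < k ^ (4 * ρ + 6 * ρ') := pow_pos hk0 _
  have hHK : k ^ (4 * ρ + 6 * ρ') ≤ k ^ (μ + 2 * ρ) := Nat.pow_le_pow_right hk0 (by omega)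
  have hXS := sum_norm_corrS2_le_chain_sharp U f hk0 h01 h12 hwle hH0 hHK ϑ (M₁ := k ^ μ) hM₀1 hNle
    (k ^ ρ) (k ^ (2 * ρ)) hnB
  -- Step 4a: the exceptional-set term (62)–(63)
  have hsc := sc_term_le hk hμ₀' (by omega) (by omega) (by omega) hρ hC0 hd0
    (Mlen := k ^ μ - k ^ (μ - 1)) (M₁ := k ^ μ) (N := k ^ ν - k ^ (ν - 1))
    (Nat.sub_le _ _) rfl (Nat.sub_le _ _)
  -- Step 4b: the smoothing term (64)–(70)
  have hsms := sms_term_le hk hμ₀' hw (by omega) (by omega) (by omega) hρ hd0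
    (Mlen := k ^ μ - k ^ (μ - 1)) (M₁ := k ^ μ) (Nlen := k ^ ν - k ^ (ν - 1))
    (Nat.sub_le _ _) rfl (Nat.sub_le _ _)
  -- Step 4c: the diagonal term (73)–(84) with Lemma 10
  have hHR : 2 * k ^ (4 * ρ + 6 * ρ') * k ^ ρ ≤ k ^ (μ + 2 * ρ) := by
    calc 2 * k ^ (4 * ρ + 6 * ρ') * k ^ ρ ≤ k * k ^ (4 * ρ + 6 * ρ') * k ^ ρ := by gcongr
      _ = k ^ (4 * ρ + 6 * ρ' + 1 + ρ) := by rw [← pow_succ', ← pow_add]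
      _ ≤ k ^ (μ + 2 * ρ) := Nat.pow_le_pow_right hk0 (by omega)
  have hT2 : 2 ≤ k ^ (ρ + 4 * ρ' + b) := by
    calc 2 ≤ k := hk
      _ = k ^ 1 := (pow_one k).symm
      _ ≤ _ := Nat.pow_le_pow_right hk0 (by omega)
  have hT1 : 1 ≤ k ^ (ρ + 4 * ρ' + b) - 1 := by omega
  have hRS := sum_Icc_S7_le U f k μ₀ μ₁ (μ + 2 * ρ) (ρ + 4 * ρ' + b) hk0
  have hDG := sum_sum_norm_corrS4rDiag_le U f hk0 h01 h12 (S := k ^ (2 * ρ)) hHR hT1 (k ^ (μ - 1)) (k ^ μ)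
    (k ^ (ν - 1)) (k ^ ν) hRS
  have hsum : μ₀ + lam + (ρ + 4 * ρ' + b) = μ + 2 * ρ := by omega
  have hρ3 : 4 * ρ' + a < ρ + 4 * ρ' + b := by omega
  have hlamle : μ₁ - μ₀ ≤ lam := by omega
  have hL10 := sum_sum_norm_sq_ghat_conj_mul_le U hk hcarry hfour h01 hlamle hsum hρ3 hc
  have hΛ' : lam + (4 * ρ' + a) - (μ₁ - μ₀) ≤ μ + 2 * ρ := by omega
  have hRSB := rs_bound hk hμ₀ hΛ' hγ hL10
  have hdg := diag_term_le hk hμ₁ hμ₀ hlam hρ' (by omega) (by omega) hρ hC0 (by positivity) hRSB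
    (Mlen := k ^ μ - k ^ (μ - 1)) (Nlen := k ^ ν - k ^ (ν - 1)) (Nat.sub_le _ _) (Nat.sub_le _ _)
    (X := ∑ s ∈ Ico 1 (k ^ (2 * ρ)), ∑ r ∈ Ico 1 (k ^ ρ),
      ‖corrS4rDiag U f k μ₀ μ₁ (μ + 2 * ρ) (k ^ (4 * ρ + 6 * ρ')) (k ^ (μ - 1)) (k ^ μ)
        (k ^ (ν - 1)) (k ^ ν) r s‖)
    (by rw [Finset.sum_comm]; exact hDG)
  -- Step 4d: the off-diagonal term (85)
  have hH2 : 2 * k ^ (4 * ρ + 6 * ρ') ≤ k ^ (μ + 2 * ρ) :=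
    le_trans (Nat.le_mul_of_pos_right _ (pow_pos hk0 ρ)) hHR
  have hof := off_term_le hk hμ₀' hμ hν hρ (dn := Fintype.card d) (M₁ := k ^ μ)
    (Nlen := k ^ ν - k ^ (ν - 1)) rfl (Nat.sub_le _ _)
    (X := fun r s => ‖corrS4rOff U f k μ₀ μ₁ (μ + 2 * ρ) (k ^ (4 * ρ + 6 * ρ')) (k ^ (μ - 1)) (k ^ μ)
      (k ^ (ν - 1)) (k ^ ν) r s‖)
    (fun r s => norm_corrS4rOff_le_n U f hk0 h02 μ₁ hH2 (k ^ (μ - 1)) (k ^ μ) (k ^ (ν - 1)) (k ^ ν) r s)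
  -- Step 5: `∑_s |S₂'(s)| · k^{2ρ'} ≤ RSMN · Ψ`
  have hXSb := chain4_le hXS hsc hsms hdg hof
  have hXS' : (∑ s ∈ Ico 1 (k ^ (2 * ρ)), ‖corrS2 ϑ (umat U (trunc k (μ + 2 * ρ) f)) (k ^ (μ - 1)) (k ^ μ)
      (k ^ (ν - 1)) (k ^ ν) (k ^ ρ) (k ^ μ₁) s‖) * ((k : ℝ) ^ ρ') ^ 2 ≤
      ((k ^ ρ : ℕ) : ℝ) * ((k ^ (2 * ρ) : ℕ) : ℝ) * (k : ℝ) ^ μ * (k : ℝ) ^ ν *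
        (16 * (Fintype.card d : ℝ) * C + 20 * (Fintype.card d : ℝ) +
            ((32 * (Fintype.card d : ℝ) * C * (1 + Real.log ((k : ℝ) ^ (μ + 2 * ρ))) *
                  (2 * ((k ^ (μ + 2 * ρ)).divisors.card : ℝ) + 2 + (1 + Real.log ((k : ℝ) ^ (μ + 2 * ρ)))) +
                64 * (Fintype.card d : ℝ) * (1 + ((k ^ (μ + 2 * ρ)).divisors.card : ℝ))) +
              (64 * (Fintype.card d : ℝ) * (1 + Real.log ((k : ℝ) ^ (μ + 2 * ρ))) *
                  (2 * ((k ^ (μ + 2 * ρ)).divisors.card : ℝ) + 2 + (1 + Real.log ((k : ℝ) ^ (μ + 2 * ρ)))) +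
                32 * (Fintype.card d : ℝ) * (1 + ((k ^ (μ + 2 * ρ)).divisors.card : ℝ))) +
              (2 * (Fintype.card d : ℝ) * (1 + Real.log ((k : ℝ) ^ (μ + 2 * ρ))) *
                  (18 * (Fintype.card d : ℝ) * (1 + Real.log ((k : ℝ) ^ (μ + 2 * ρ))) ^ 2 * (k : ℝ) ^ (3 * a) +
                    8 * (Fintype.card d : ℝ) * C) +
                2 * ((k ^ (μ + 2 * ρ)).divisors.card : ℝ) * (Fintype.card d : ℝ) ^ 2 * (1 + Real.log ((k : ℝ) ^ (μ + 2 * ρ))) +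
                3 * (Fintype.card d : ℝ) ^ 2 * (1 + Real.log ((k : ℝ) ^ (μ + 2 * ρ))) ^ 2) +
              (Fintype.card d : ℝ) ^ 2 * (1 + (1 + Real.log ((k : ℝ) ^ (μ + 2 * ρ)))) ^ 2 *
                (4 + (1 + Real.log ((k : ℝ) ^ (μ + 2 * ρ))))) / (k : ℝ) ^ ρ +
            72 * (Fintype.card d : ℝ) ^ 2 * ((k ^ (μ + 2 * ρ)).divisors.card : ℝ) * (1 + Real.log ((k : ℝ) ^ (μ + 2 * ρ))) ^ 2 *
              (k : ℝ) ^ (3 * a) / (k : ℝ) ^ (2 * g) +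
            32 * (Fintype.card d : ℝ) ^ 2 * C * ((k ^ (μ + 2 * ρ)).divisors.card : ℝ) / (k : ℝ) ^ a +
            4 * ((k ^ (μ + 2 * ρ)).divisors.card : ℝ) * (Fintype.card d : ℝ) ^ 2 * (1 + Real.log ((k : ℝ) ^ (μ + 2 * ρ))) / (k : ℝ) ^ b) := by
    refine (mul_le_mul_of_nonneg_right hXSb (by positivity)).trans (le_of_eq ?_)
    push_cast
    field_simp
    ring
  have hΨ0 : 0 ≤ (16 * (Fintype.card d : ℝ) * C + 20 * (Fintype.card d : ℝ) +
            ((32 * (Fintype.card d : ℝ) * C * (1 + Real.log ((k : ℝ) ^ (μ + 2 * ρ))) *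
                  (2 * ((k ^ (μ + 2 * ρ)).divisors.card : ℝ) + 2 + (1 + Real.log ((k : ℝ) ^ (μ + 2 * ρ)))) +
                64 * (Fintype.card d : ℝ) * (1 + ((k ^ (μ + 2 * ρ)).divisors.card : ℝ))) +
              (64 * (Fintype.card d : ℝ) * (1 + Real.log ((k : ℝ) ^ (μ + 2 * ρ))) *
                  (2 * ((k ^ (μ + 2 * ρ)).divisors.card : ℝ) + 2 + (1 + Real.log ((k : ℝ) ^ (μ + 2 * ρ)))) +
                32 * (Fintype.card d : ℝ) * (1 + ((k ^ (μ + 2 * ρ)).divisors.card : ℝ))) +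
              (2 * (Fintype.card d : ℝ) * (1 + Real.log ((k : ℝ) ^ (μ + 2 * ρ))) *
                  (18 * (Fintype.card d : ℝ) * (1 + Real.log ((k : ℝ) ^ (μ + 2 * ρ))) ^ 2 * (k : ℝ) ^ (3 * a) +
                    8 * (Fintype.card d : ℝ) * C) +
                2 * ((k ^ (μ + 2 * ρ)).divisors.card : ℝ) * (Fintype.card d : ℝ) ^ 2 * (1 + Real.log ((k : ℝ) ^ (μ + 2 * ρ))) +
                3 * (Fintype.card d : ℝ) ^ 2 * (1 + Real.log ((k : ℝ) ^ (μ + 2 * ρ))) ^ 2) +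
              (Fintype.card d : ℝ) ^ 2 * (1 + (1 + Real.log ((k : ℝ) ^ (μ + 2 * ρ)))) ^ 2 *
                (4 + (1 + Real.log ((k : ℝ) ^ (μ + 2 * ρ))))) / (k : ℝ) ^ ρ +
            72 * (Fintype.card d : ℝ) ^ 2 * ((k ^ (μ + 2 * ρ)).divisors.card : ℝ) * (1 + Real.log ((k : ℝ) ^ (μ + 2 * ρ))) ^ 2 *
              (k : ℝ) ^ (3 * a) / (k : ℝ) ^ (2 * g) +
            32 * (Fintype.card d : ℝ) ^ 2 * C * ((k ^ (μ + 2 * ρ)).divisors.card : ℝ) / (k : ℝ) ^ a +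
            4 * ((k ^ (μ + 2 * ρ)).divisors.card : ℝ) * (Fintype.card d : ℝ) ^ 2 * (1 + Real.log ((k : ℝ) ^ (μ + 2 * ρ))) / (k : ℝ) ^ b) := by
    by_contra hneg
    push Not at hneg
    have hpos : (0 : ℝ) < ((k ^ ρ : ℕ) : ℝ) * ((k ^ (2 * ρ) : ℕ) : ℝ) * (k : ℝ) ^ μ * (k : ℝ) ^ ν := by
      positivity
    have h1 := mul_neg_of_pos_of_neg hpos hneg
    have h2 : (0 : ℝ) ≤ (∑ s ∈ Ico 1 (k ^ (2 * ρ)), ‖corrS2 ϑ (umat U (trunc k (μ + 2 * ρ) f)) (k ^ (μ - 1))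
        (k ^ μ) (k ^ (ν - 1)) (k ^ ν) (k ^ ρ) (k ^ μ₁) s‖) * ((k : ℝ) ^ ρ') ^ 2 := by positivity
    linarith
  -- Step 6: the carry exceptions of the box
  have hEB : ((carryExceptionsBox k f μ ν ρ).card : ℝ) * ((k ^ ρ : ℕ) : ℝ) ≤
      3 * (k * C) * (k : ℝ) ^ μ * (k : ℝ) ^ ν := by
    have h := card_carryExceptionsBox_le hk hcarry (μ := μ) (by omega : 2 * ρ < ν)
    have e : ((μ : ℝ) + ν - 1 * ρ) = ((μ + ν - ρ : ℕ) : ℝ) := by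
      push_cast [Nat.cast_sub (by omega : ρ ≤ μ + ν)]; ring
    rw [e, Real.rpow_natCast] at h
    have epow : (k : ℝ) ^ (μ + ν - ρ) * (k : ℝ) ^ ρ = (k : ℝ) ^ μ * (k : ℝ) ^ ν := by
      rw [← pow_add, ← pow_add]; congr 1; omega
    calc ((carryExceptionsBox k f μ ν ρ).card : ℝ) * ((k ^ ρ : ℕ) : ℝ)
        ≤ 3 * k * C * (k : ℝ) ^ (μ + ν - ρ) * ((k ^ ρ : ℕ) : ℝ) :=
          mul_le_mul_of_nonneg_right h (Nat.cast_nonneg _)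
      _ = 3 * (k * C) * ((k : ℝ) ^ (μ + ν - ρ) * (k : ℝ) ^ ρ) := by push_cast; ring
      _ = _ := by rw [epow]; ring
  -- Step 7: the final combination
  have hM'M : ((k ^ μ - k ^ (μ - 1) : ℕ) : ℝ) ≤ (k : ℝ) ^ μ := by
    have : ((k ^ μ - k ^ (μ - 1) : ℕ) : ℝ) ≤ ((k ^ μ : ℕ) : ℝ) := by exact_mod_cast Nat.sub_le _ _
    simpa using this
  have hN'N : ((k ^ ν - k ^ (ν - 1) : ℕ) : ℝ) ≤ (k : ℝ) ^ ν := by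
    have : ((k ^ ν - k ^ (ν - 1) : ℕ) : ℝ) ≤ ((k ^ ν : ℕ) : ℝ) := by exact_mod_cast Nat.sub_le _ _
    simpa using this
  have hRN : ((k ^ ρ : ℕ) : ℝ) ≤ (k : ℝ) ^ ν := by
    push_cast; exact pow_le_pow_right₀ hk1R (by omega)
  have hSR : ((k ^ (2 * ρ) : ℕ) : ℝ) = ((k ^ ρ : ℕ) : ℝ) ^ 2 := by push_cast; ring
  have hfin := typeII_final_abstract (M := (k : ℝ) ^ μ) (N := (k : ℝ) ^ ν) (P := (k : ℝ) ^ ρ')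
    (kC := k * C) (by positivity) (by positivity) (by positivity) (by positivity) hd0 hΨ0
    (Nat.cast_nonneg _) hM'M (Nat.cast_nonneg _) hN'N hRN hSR (Nat.cast_nonneg _) (by positivity)
    (by positivity) hT hY hXS' hEB
  simp only [Nat.cast_pow] at hfin
  exact hfin

end Literature.NumberTheory.LFunctions.MauduitRivat
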